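import Mathlib
import HarnessLib
import Literature.Analysis.FluidPDE.VorticityCalculus
import Summits.NavierStokesRegularity.NavierStokesRegularity.Theses.PoloidalWindowDoor
import Summits.NavierStokesRegularity.NavierStokesRegularity.Theses.LoopPeriodRatchet
import Summits.NavierStokesRegularity.NavierStokesRegularity.Theorems.PoloidalWindowDoorPoloidalWindowRigidityHotLoopsReduction
import Summits.NavierStokesRegularity.NavierStokesRegularity.Theorems.PoloidalWindowDoorPoloidalWindowRigidityFirstIntegral
import Summits.NavierStokesRegularity.NavierStokesRegularity.Theorems.PoloidalWindowDoorPoloidalWindowRigidityZeroModeHeat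
import Summits.NavierStokesRegularity.NavierStokesRegularity.Theorems.PoloidalWindowDoorPoloidalWindowRigidityZeroModeOseen
import Summits.NavierStokesRegularity.NavierStokesRegularity.Theorems.PoloidalWindowDoorPoloidalWindowRigidityFluxTransport
import Summits.NavierStokesRegularity.NavierStokesRegularity.Theorems.PoloidalWindowDoorPoloidalWindowRigidityHotPlaneConst
import Summits.NavierStokesRegularity.NavierStokesRegularity.Theorems.PoloidalWindowDoorPoloidalWindowRigidityDiscDichotomy

/-!
# Crux `PoloidalWindowRigidity` (K2, stmt-NavierStokesRegularity-19708) + item `LrcModEntire` (stmt-20428) — LINE 15 `hot_split`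
# (IDEATOR seat ns-idea-8, generation 7; lens «barrier»; bears_on LADDER-NS N0, rung N0-LocalTubeDoorPoloidal, THICK column)
# v1.1 — erratum in the C2a docstrings only (`Γ` is non-closed, not necessarily unbounded); every statement identical to v1 (567c54c981f4).
# v1.2 — critic prices P15-3/P15-4 (idea-crit-7, 22:47Z): cells C2a and C2b now CARRY THE FROZEN LAW as an explicit hypothesis
#   `∀ s < 0, ∀ y, ⟪fderiv ℝ (v s) y (curl (v s) y), e₃⟫ = 0`, discharged BY NAME in the kernel from the landed
#   `…Theorems.PoloidalWindowDoorPoloidalWindowRigidityFirstIntegral.stub_firstIntegral` (so a closer of C2a starts from «the vortex line through a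
#   hot point is hot» by name); C2b docstring: isolated hot points are excluded by `Peakless` itself (K = {y}), no wall needed.  A1, C1 unchanged.
# v1.3 (generation 8, 2026-08-29) — CELLS A1 AND C1 ARE CLOSED IN THIS FILE: A1 is discharged BY NAME from the landed
#   `…Theorems.PoloidalWindowDoorPoloidalWindowRigidityHotPlaneConst.stub_hotPlaneConst` (K2-p2 g12, p677063); C1 by the INLINED kernel of LINE 16 `zero_mode`
#   v1.2 (`Lines/zero_mode.lean` 2b5c3f177713): zero-mode law Z = Z-heat ∧ Z-oseen and flux transport F, all three discharged BY NAME from the landed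
#   `…ZeroModeHeat` (p681062), `…ZeroModeOseen` (p684523, with `…ZeroModeRadial/BoxKernel/Boxes`, K2-p2 g13), `…FluxTransport` (p680813), then
#   `noHotPlane_of_zeroMode_of_flux`, `cellC1_of_noHotPlane` (sorry-free) ⇒ `stub_cellC1 := cellC1_of_noHotPlane zeroMode_noHotPlane`.  Critic idea-crit-7 g5
#   BOOKED C1 01:10:11Z (a second, independent sorry-free proof is `Lines/zero_mode_bump.lean` v2.1 7846008250bc, PASS A−).  Statements of every cell, of
#   HL3′ and of the kernel are UNCHANGED (v1.2).  Sorries in v1.3 = C2a, C2b (open cells) · S0, wall (shared research stubs).  HL3′ census: 1/3 cells closed.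
# v1.4 (generation 8, 2026-08-29, critic idea-crit-7 g5 «C2a SIZING» 01:27:47Z) — THE M-SIZED INTERIOR OF THE RIDGE CELLS IS NAMED: the hot set
#   `hotSet v = {y₂ = 0, v₂(−1,y) = N}` and four REDUCTIONS stated ONCE for both cells as named Props with hand-target stubs — R1 `HotSetClosedCritical` (S),
#   R2 `VortexLineHot` (M; the vortex line through a hot point is a hot curve of `P₀`, frozen law + Picard–Lindelöf), R3 `NoCompactIsolatedHotPiece` (S; Peakless
#   unpacked at `(−1, P₀, sign N, |N|)`), R4 `HotSetNoInterior` (M; identity theorem on the plane) — and the two RESIDUES C2a′ `stub_cellC2aRidge` (unbounded /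
#   accumulating hot vortex ridge) and C2b′ `stub_cellC2bRidge` (null ridge), OPEN research; `stub_cellC2a` / `stub_cellC2b` keep their v1.2 statements
#   byte-for-byte and are now DERIVED: `stub_cellC2a := cellC2a_of_reductions R1 R2 R3 R4 C2a′`, `stub_cellC2b := cellC2b_of_reductions R1 R3 R4 C2b′` (kernels
#   sorry-free).  Sorries in v1.4 = R1, R2, R3, R4 (hand targets) · C2a′, C2b′ (open residues) · S0, wall.  BC7 probes of C2a′ / C2b′ × crux 19708 and × the
#   route leaf `PoloidalWindowDoor.Target`: CLEAN ×4 (P1/P2/P2h/P3/P5 ok; P4 skipped — conclusion `False`).  HL3′ census unchanged: 1/3 cells closed (C1).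
# v1.4.1 — R1–R4 PROVED IN THIS FILE (section `RProofs`, helper `slice_facts`; tools by name: `…Window.isTypeIAncientMild_of_class`,
#   `IsTypeIAncientMild.contDiff_slice/analyticOnNhd_slice_univ`, `contDiff_curl`, `fderiv_apply_coord_vec3`, `…LoopTangencyPin.fderiv_eq_zero_of_abs_le/apply_integralCurve_eq`,
#   Mathlib Picard–Lindelöf, `…DiscDichotomy.eq_const_on_plane_of_analytic`).  Sorries in v1.4.1 = C2a′, C2b′ (open residues) · S0, wall — all research.
#   A Theorems port of R1–R4 (one S/M file, copy of `RProofs`) is the hands' call; nothing here closes an item.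
# v1.5 — NEW KERNEL THEOREM R5 `hotComponent_unbounded : HotComponentUnbounded` (PROVED; topological core `not_isBounded_connectedComponentIn` =
#   Šura-Bura in `ℝ³` via Mathlib `connectedComponent_eq_iInter_isClopen` + `IsCompact.elim_finite_subfamily_closed` on the compact space `H ∩ closedBall 0 (R+1)`):
#   in the pinned peakless class EVERY connected component of the hot set `H ⊂ P₀` is UNBOUNDED; `hotSpot_component_unbounded`: the component of the
#   hot spot `0` reaches infinity.  The residues' ridge is therefore UNBOUNDED (the «bounded accumulating» alternative is dead).  Statements of all stubs /
#   residues / kernels unchanged; sorries = C2a′, C2b′, S0, wall.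
# v1.6 — R6 `hot_meets_every_circle` (PROVED: for every `R ≥ 0` a hot point with `‖y‖ = R` — intermediate value of the norm on the unbounded connected
#   component of `0`) and R7 `planarArgmax_component_unbounded` (PROVED: on ANY horizontal plane at ANY time `s < 0`, an attained planar maximum of `σv₂(s,·)`
#   has an argmax set whose component through the maximiser is UNBOUNDED — the all-planes/all-times form of R5, same Šura-Bura core).  Sorries = C2a′, C2b′, S0, wall.

**WHAT THIS LINE IS.**  A census-responsive TYPED TRICHOTOMY of the one open residue of the THICK column, the peakless statement HL3′
(`stub_peaklessEmpty` of `Lines/hot_loops.lean` v4.3 = `Lines/loop_island.lean`), asked for by director KEY-NS #158(a) («a census row per HL3′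
attempt»): every attempt recorded in `Lines/hot_loops-HL3-census.md` attacks either the HOT PLANE (C1) or the HOT RIDGE (C2); here the three
cells are Lean statements, each composes to HL3′ — hence to the crux 19708 and to 20428 BY NAME — through a kernel-checked case split, and one
closing of one cell by any hand COUNTS.  No cell is claimed; no summit is proved by any line.

**THE SPLIT.**  In HL3′'s world the profile `v` is pinned: `N := v₂(−1,0) ≠ 0`, `√(−t)|v₂(t,x)| ≤ |N|` everywhere, `∇v₂(−1,0) = 0`, time/Laplace
pins, a THICK twisting window accumulating at `(−1,0)`, and PEAKLESS (no island bracket anywhere).  Let `P₀ := {y | y 2 = 0}` and call `y ∈ P₀`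
HOT if `v₂(−1,y) = N`.  Exactly one of:
* **C1 (hot plane)** every point of `P₀` is hot.  Then (stub A1, PROVABLE, M) `v(−1,·)` is CONSTANT on `P₀`: `∂_z v₂ = 0` on `P₀` (each hot point is
  extremal in `z` by the global bound), `div_h v_h = −∂_z v₂ = 0` and `curl_h v_h = ω₂ = 0` on `P₀`, so each `vᵢ(−1,·,·,0)` (`i = 0,1`) is planar
  harmonic and bounded ⇒ constant (tree `Literature.Analysis.FluidPDE.isConst_of_harmonic_bounded`).  Cell `stub_cellC1`: a pinned peakless thick
  profile whose time-`−1` slice is constant on the hot-spot plane does not exist.  OPEN.  (Census C1: K2-p3's pressure route died — `σ∂_z p ≤ −|N|/2`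
  on `P₀` with `Δp = 0` there is consistent; layered shears give `∂_z p = 0`, so C1 needs the non-layered structure; the plane carries the shear
  potential `∂_z v_h|_{P₀} = ∇ₕα`, `σΔₕα = −σ∂_zz v₂ ≥ 0`, whose level curves are the vortex lines of `P₀` and, by `Lines/loop_island.lean`, never closed.)
* **C2a (hot regular vortex line)** some point of `P₀` is not hot, and some HOT point `y ∈ P₀` has `curl v(−1) y ≠ 0`.  Since `v₂` is a first
  integral of the planar vorticity field (frozen law), the whole vortex line through `y` is hot: the hot set contains a non-stationary vortex line `Γ ⊂ P₀`,
  NOT CLOSED (a closed `Γ` in the non-flat plane `P₀` bounds an island by J + D of `Lines/loop_island.lean`, excluded by peakless), hence either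
  unbounded or a bounded arc whose limit sets consist of HOT VORTICITY ZEROS (Poincaré–Bendixson: a limit cycle would again be a loop); along `Γ`:
  `∇v₂ = 0`, `ω ⊥ ∂_z v_h`, `∂_z v_h` is NORMAL to `Γ` and the frozen slope `μ → ∞` at `Γ` (`Λ(w) ~ (N − σw)^{-1/2}`).  Cell `stub_cellC2a`.  OPEN.
  (Census C2: no maximum principle along a curve; `σ∂_z p ≤ −|N|/2 + σ∂_zz v₂` only ON `Γ`.)
* **C2b (null ridge)** some point of `P₀` is not hot and EVERY hot point of `P₀` is a vorticity zero.  Then on the hot set `ω = 0`, `∇v₂ = 0`,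
  `∂_z v_h = 0`, `Dv = ` a trace-free planar strain (thread-zero structure, tree `…ThreadZeroStructure`); the hot set is a compact-free analytic set of
  dimension ≤ 1 in `P₀` through `0` (an isolated hot point `y` — indeed any compact union of components of the hot set — is an island bracket with
  `K = {y}` under the `t = −1` global bound, so `Peakless` itself excludes it; no wall needed inside the cell).
  Cell `stub_cellC2b`.  OPEN.  (Finite-jet barrier: no contradiction from jets at `Γ`; a kill must be global.)

KERNEL: `peaklessEmpty_of_split : A1 → C1 → C2a → C2b → HL3′` (two `by_cases`), `hotSplit_peaklessEmpty : HL3′`, and the crux / item BY NAME through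
the landed `…HotLoopsReduction.poloidalWindowRigidity_of_NUGRS_of_growth_of_peakless` / `lrcModEntire_of_NUGRS_of_growth_of_peakless` from the shared
research stub S0 (`stub_localTHEmptyHypNUGRS`, verbatim), the wall ⟨27893⟩ (`stub_wall : LoopPeriodRatchet.FrequencyGrowthExponent`, by name; ⟺ NoIslands
by `Lines/loop_island.lean`) and the three cells.  Sorries = stubs only: S0, wall, and (v1.4.1) the residues C2a′, C2b′ — v1.3: A1 and C1 CLOSED (by name / inlined LINE 16 kernel);
v1.4: C2a, C2b DERIVED from R1–R4 + C2a′/C2b′; v1.4.1: R1–R4 PROVED in the file.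

**WHY THIS LINE / WHY (MODESTLY) NOVEL.**  Not a new mechanism: a typed census scaffold.  New in Lean: (i) the hot-plane cell reduced to the
CONSTANT-PLANE form (A1, planar harmonic Liouville — the only provable new lemma here); (ii) the C2 residue split by the dichotomy «is the hot set
through 0 a union of non-stationary vortex lines or of vorticity zeros» (ridge invariance under the vortex flow), which is where the census attempts
actually differ (pressure/ridge arguments need `ω ≠ 0` on `Γ`; thread/centre arguments need `ω = 0`).  Levers considered this generation and
REJECTED by the seat's own critic (recorded so they are not re-filed): flux-defect + pressure on the hot plane (no contradiction; Galilean boost loses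
Type I), second-pin extremal functionals (unsigned pressure), `(∂_t+v·∇−Δ)ψ` source law (unsigned), the `λ`-transport identity `λJ∇ₕ∂_z p = …` (= K2's
THICK normal form), z-convexity of `μ>0` island tops `∂_zz v₂ = −μΔₕv₂` (= K2's pin computation `μ(p₀) ≤ 0`), `(w,ψ)`-arc portraits (costume),
layer rigidity (support only), a caloric «heat column» refutation of ⟨27893⟩ (sign error; bounded ancient caloric ⇒ 0).

C0 (self-critic): Reduction 3/5 (each cell strictly weaker than HL3′; jointly equivalent) · Attack 2/5 (no mechanism for any cell; A1 is the first
lemma, provable) · Lever 2/5 (bookkeeping + one Liouville lemma; nearest: hot_loops HL3′ itself and K2-p3's informal C1/C2 census) · Barriers 3/5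
(finite-jet / Cartan–Kähler barrier applies to every LOCAL attack on C2a/C2b — stated; C1's constant plane is a GLOBAL object) · Killable 4/5 (each
cell is refutable by exhibiting one pinned profile of that type; C1 is the cheapest: «does a class poloidal profile constant on a plane exist?»).
CHEAPEST FALSIFIER of the scaffold itself: none (it is a case split); of its usefulness: the critic rules that typed cells without mechanism are not
lines (then this file stands as the Lean form of census §C1/§C2 and nothing more).  INSTRUMENT ROW: none run.  BC7: probes of `CellC1`, `CellC2a`,
`CellC2b`, `HotPlaneConst` against `…PoloidalWindowDoor.PoloidalWindowRigidity`: see `Lines/hot_split.md`.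
PROCESS (KEY-NS #68/#69): files only — no `skeleton check --crux`, no `propose`.
-/

open scoped InnerProductSpace RealInnerProductSpace Laplacian

-- the summit and its single sub-problem share the name (CONVENTIONS §1)
set_option linter.dupNamespace false

namespace Summit.NavierStokesRegularity.NavierStokesRegularity.Cruxes.PoloidalWindowRigidity.HotSplit

open Set Function MeasureTheory
open Literature.Analysis Literature.Analysis.FluidPDE
open Summit.NavierStokesRegularity.NavierStokesRegularity.Theses.LoopPeriodRatchet
open Summit.NavierStokesRegularity.NavierStokesRegularity.Theses.PoloidalWindowDoor
open Summit.NavierStokesRegularity.NavierStokesRegularity.Theorems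

/-! ## The three hypothesis packages of HL3′, named -/

/-- **Pinned** — the class binders and the hot-spot pins of HL3′ (everything before the window `W`), in HL3′'s order: Type-I decay, continuity,
mild identity, div-free, e₃-poloidal, `N := v₂(−1,0) ≠ 0`, the global bound `√(−t)|v₂| ≤ |N|`, `∇v₂(−1,0) = 0`, the time and Laplace pins. -/
def Pinned (C : ℝ) (v : ℝ → EuclideanSpace ℝ (Fin 3) → EuclideanSpace ℝ (Fin 3)) : Prop :=
  Literature.Analysis.FluidPDE.HasTypeITimeDecay C v ∧
  ContinuousOn (Function.uncurry v) (Set.Iio (0 : ℝ) ×ˢ Set.univ) ∧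
  (∀ s t : ℝ, s < t → t < 0 → ∀ x, v t x =
    Literature.Analysis.UnboundedOperators.heatExtension (v s) (t - s) x -
      Literature.Analysis.FluidPDE.oseenDuhamel 1 s v v t x) ∧
  (∀ t < 0, Literature.Analysis.FluidPDE.VectorCalculus.IsDivFree (v t)) ∧
  (∀ s < 0, ∀ y, ⟪Literature.Analysis.FluidPDE.curl (v s) y, EuclideanSpace.single 2 1⟫_ℝ = 0) ∧
  v (-1) 0 2 ≠ 0 ∧ (∀ t < 0, ∀ x, Real.sqrt (-t) * |v t x 2| ≤ |v (-1) 0 2|) ∧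
  (∀ h : EuclideanSpace ℝ (Fin 3), fderiv ℝ (v (-1)) 0 h 2 = 0) ∧
  (deriv (fun s => v s 0 2) (-1) = v (-1) 0 2 / 2 ∧ v (-1) 0 2 * (Δ (fun y => v (-1) y 2)) 0 ≤ 0)

/-- **ThickWindow** — HL3′'s window data: `W` open in the past, THICK twisting non-degenerate on `W`, not (TH) on any subwindow, accumulating at
`(−1,0)`. -/
def ThickWindow (v : ℝ → EuclideanSpace ℝ (Fin 3) → EuclideanSpace ℝ (Fin 3)) (W : Set (ℝ × EuclideanSpace ℝ (Fin 3))) : Prop :=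
  IsOpen W ∧ W ⊆ Set.Iio (0 : ℝ) ×ˢ Set.univ ∧
  (∀ z ∈ W, (Literature.Analysis.FluidPDE.curl (v z.1) z.2 ≠ 0 ∧
      (fderiv ℝ (v z.1) z.2 (EuclideanSpace.single 0 1) 2 ≠ 0 ∨ fderiv ℝ (v z.1) z.2 (EuclideanSpace.single 1 1) 2 ≠ 0) ∧
      (fderiv ℝ (v z.1) z.2 (EuclideanSpace.single 2 1) 0 ≠ 0 ∨ fderiv ℝ (v z.1) z.2 (EuclideanSpace.single 2 1) 1 ≠ 0)) ∧
    (fderiv ℝ (fun x => fderiv ℝ (v z.1) x (EuclideanSpace.single 2 1) 2) z.2 (EuclideanSpace.single 0 1) *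
          fderiv ℝ (v z.1) z.2 (EuclideanSpace.single 1 1) 2 -
        fderiv ℝ (fun x => fderiv ℝ (v z.1) x (EuclideanSpace.single 2 1) 2) z.2 (EuclideanSpace.single 1 1) *
          fderiv ℝ (v z.1) z.2 (EuclideanSpace.single 0 1) 2 ≠ 0)) ∧
  (∀ m : ℝ → ℝ → ℝ, ∀ W₁ : Set (ℝ × EuclideanSpace ℝ (Fin 3)), W₁ ⊆ W → IsOpen W₁ → W₁.Nonempty →
      ∃ z ∈ W₁, ∃ b : Fin 3, b ≠ 2 ∧
        fderiv ℝ (v z.1) z.2 (EuclideanSpace.single 2 1) b ≠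
          m z.1 (z.2 2) * fderiv ℝ (v z.1) z.2 (EuclideanSpace.single b 1) 2) ∧
  (∀ r : ℝ, 0 < r → (Metric.ball ((-1 : ℝ), (0 : EuclideanSpace ℝ (Fin 3))) r ∩ W).Nonempty)

/-- **Peakless** — HL3′'s last hypothesis: no island bracket of `σ·v₂(s,·)` on any horizontal plane at any time `s < 0`. -/
def Peakless (v : ℝ → EuclideanSpace ℝ (Fin 3) → EuclideanSpace ℝ (Fin 3)) : Prop :=
  ∀ (s z₀ σ M : ℝ) (K O : Set (EuclideanSpace ℝ (Fin 3))), s < 0 →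
    ((σ = 1 ∨ σ = -1) ∧ IsCompact K ∧ K.Nonempty ∧ (∀ y ∈ K, y 2 = z₀ ∧ σ * v s y 2 = M) ∧
      IsOpen O ∧ K ⊆ O ∧ (∀ y ∈ O, y 2 = z₀ → σ * v s y 2 ≤ M) ∧
      (∀ y ∈ O, y 2 = z₀ → σ * v s y 2 = M → y ∈ K)) → False

/-! ## Stub A1 (provable) — the hot plane is a constant plane -/

/-- **A1 `stub_hotPlaneConst` (PROVABLE, M).**  If every point of the hot-spot plane `P₀ = {y 2 = 0}` is hot (`v₂(−1,y) = N`), then the time-`−1`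
slice is CONSTANT on `P₀` and `∂_z v₂ = 0` there.  Route: each `y ∈ P₀` maximises `|v₂(−1,·)|` over `ℝ³` (global bound at `t = −1`), so
`∇v₂(−1,y) = 0` (tree `contDiff_slice`); on `P₀`, `div_h v_h = −∂_z v₂ = 0` (div-free) and `∂₀v₁ − ∂₁v₀ = ω₂ = 0` (poloidal), hence
`vᵢ(−1,·,·,0)` (`i = 0,1`) are planar harmonic (`Δₕvᵢ = ∂ᵢ div_h ∓ ∂_{1−i} curl_h = 0`) and bounded by `C` ⇒ constant
(`Literature.Analysis.FluidPDE.isConst_of_harmonic_bounded` on `EuclideanSpace ℝ (Fin 2)`, transported along `y ↦ (y 0, y 1)`). -/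
theorem stub_hotPlaneConst :
    ∀ (C : ℝ) (v : ℝ → EuclideanSpace ℝ (Fin 3) → EuclideanSpace ℝ (Fin 3)), Pinned C v →
      (∀ y : EuclideanSpace ℝ (Fin 3), y 2 = 0 → v (-1) y 2 = v (-1) 0 2) →
      ∀ y : EuclideanSpace ℝ (Fin 3), y 2 = 0 →
        v (-1) y = v (-1) 0 ∧ fderiv ℝ (fun x => v (-1) x 2) y (EuclideanSpace.single 2 1) = 0 :=
  fun C v hP h y hy => PoloidalWindowDoorPoloidalWindowRigidityHotPlaneConst.stub_hotPlaneConst C v hP h y hy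

/-! ## C1 DISCHARGED (v1.3): LINE 16 `zero_mode` v1.2 inlined — flat boxes, Z (= Z-heat ∧ Z-oseen, landed), F (landed), kernel NoHotPlane, cell C1 -/

/-- The flat box `Q_{R,H} = [−R,R]² × [0,H] ⊂ ℝ³` (base in the hot-spot plane `P₀ = {x 2 = 0}`, height `H`); `|Q_{R,H}| = 4R²H`. -/
def flatBox (R H : ℝ) : Set (EuclideanSpace ℝ (Fin 3)) :=
  {x | |x 0| ≤ R ∧ |x 1| ≤ R ∧ 0 ≤ x 2 ∧ x 2 ≤ H}

/-- **Z — the zero-mode law** (flat-box, vertical-component instance).  For a class profile the mean of `v₂(t,·)` over `Q_{R,H}` is `≤ ε` in modulus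
once `R, H ≥ L₀(ε,t)`.  Proof route in the file header (heat part: `L¹`-mass of `G ∗ 1_Q`; Oseen part: oddness + `(σ+|z|²)^{-2}` bound of `oseenKernel`
⇒ `Per(Q)·log ρ_Q` boundary cost; then `s → −∞` by Type-I decay).  Tree: `Literature.Analysis.FluidPDE.oseenKernel`, `exists_norm_oseenKernel_le`,
`exists_lintegral_enorm_oseenKernel_le`, `oseenDuhamel_apply`, `UnboundedOperators.heatExtension`.  [KNSS 2009 §4; corpus:book:seregin2014 p.113] -/
def ZeroModeLaw : Prop :=
  ∀ (C : ℝ) (v : ℝ → EuclideanSpace ℝ (Fin 3) → EuclideanSpace ℝ (Fin 3)),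
    Literature.Analysis.FluidPDE.HasTypeITimeDecay C v →
    ContinuousOn (Function.uncurry v) (Set.Iio (0 : ℝ) ×ˢ Set.univ) →
    (∀ s t : ℝ, s < t → t < 0 → ∀ x, v t x =
      Literature.Analysis.UnboundedOperators.heatExtension (v s) (t - s) x -
        Literature.Analysis.FluidPDE.oseenDuhamel 1 s v v t x) →
    ∀ t : ℝ, t < 0 → ∀ ε : ℝ, 0 < ε → ∃ L₀ : ℝ, 0 < L₀ ∧ ∀ R H : ℝ, L₀ ≤ R → L₀ ≤ H →
      |∫ x in flatBox R H, v t x 2| ≤ ε * (4 * R ^ 2 * H)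

/-- **Z-heat** (PROVABLE, S/M; price P16-1): the free (caloric) evolution from time `s` has box integrals bounded by the Type-I datum times the
volume — `|∫_{Q_{R,H}} (e^{(t−s)Δ}v(s))₂| ≤ (C/√(−s))·4R²H`.  Route: pointwise `‖heatExtension (v s) (t−s) x‖ ≤ C/√(−s)` by the tree's
`Literature.Analysis.UnboundedOperators.norm_heatExtension_le` (heat kernel has mass 1; only the pointwise bound `‖v s y‖ ≤ C/√(−s)` of
`HasTypeITimeDecay` is needed), then `MeasureTheory.norm_setIntegral_le_of_norm_le_const` with `volume (flatBox R H) = 4R²H`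
(`EuclideanSpace.volume_preserving_measurableEquiv` to the product box `[−R,R]²×[0,H]`). -/
def ZeroModeHeat : Prop :=
  ∀ (C : ℝ) (v : ℝ → EuclideanSpace ℝ (Fin 3) → EuclideanSpace ℝ (Fin 3)),
    Literature.Analysis.FluidPDE.HasTypeITimeDecay C v →
    ∀ s t : ℝ, s < t → t < 0 → ∀ R H : ℝ, 0 < R → 0 < H →
      |∫ x in flatBox R H, Literature.Analysis.UnboundedOperators.heatExtension (v s) (t - s) x 2| ≤
        C / Real.sqrt (-s) * (4 * R ^ 2 * H)

/-- **stub Z-heat** (PROVABLE, S/M). -/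
theorem stub_zeroModeHeat : ZeroModeHeat :=
  fun C v => PoloidalWindowDoorPoloidalWindowRigidityZeroModeHeat.stub_zeroModeHeat C v

/-- **Z-oseen** (PROVABLE, L; price P16-1): for FIXED `s < t < 0` the box integral of `v₂(t)` exceeds that of the free evolution from time `s` by at
most `ε·|Q_{R,H}|` once `R, H ≥ L₀(s,t,ε)`.  By the mild identity the excess IS the box integral of the Oseen–Duhamel term
`(oseenDuhamel 1 s v v t ·)₂` (stated in this subtraction-free form so that the assembly below is pure arithmetic; the integrability bookkeeping —
`v t` continuous on the compact box, the heat part bounded — lives inside this stub).  Route (file header, OSEEN PART): (i) tree lemma to state first,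
`oseenKernel_neg : oseenKernel τ (−z) a b = −oseenKernel τ z a b` (each of the three terms of `Literature.Analysis.FluidPDE.oseenKernel`,
KochTataru.lean:150, carries an odd number of `z`-factors against the radial weights `heatKernel`, `oseenWeightA/B`); (ii) Fubini through the iterated
Bochner integral `oseenDuhamel_apply` (the cost driver — cf. the precession hands' experience with the same integrand); (iii) the symmetric-difference
estimate `m(Q △ (Q − 2w)) ≤ min(2|Q|, 2|w|·Per Q)` for flat boxes and `|K(τ,w)[a,b]| ≤ C_K(τ+|w|²)^{-2}|a||b|` (`exists_norm_oseenKernel_le`, `d = 3`),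
giving `∫_y|∫_Q K(τ,·−y)[a,b]| ≤ 4πC_K|a||b|·Per(Q)·(2 + log(1+ρ_Q²/4τ))`, `ρ_Q = |Q|/Per Q = RH/(R+2H)·2 ≥ min(R,H)/2`… ; (iv) the time integral
`∫_s^t ‖v(τ)‖_∞² dτ ≤ C²·log((−s)/(−t))` (Type-I, τ-wise) — the `log(−s)` factor is why `L₀` depends on `s` (ORDER: the assembly fixes `s(ε,t)` FIRST,
then takes `L₀(s,t,ε/2)` from this stub; price P16-2).  Net: excess `≤ C′·C²·log((−s)/(−t))·Per(Q)·(3 + log(1+ρ_Q²/4(t−s)))`, and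
`Per(Q)·log ρ_Q/|Q| → 0` as `min(R,H) → ∞`. -/
def ZeroModeOseen : Prop :=
  ∀ (C : ℝ) (v : ℝ → EuclideanSpace ℝ (Fin 3) → EuclideanSpace ℝ (Fin 3)),
    Literature.Analysis.FluidPDE.HasTypeITimeDecay C v →
    ContinuousOn (Function.uncurry v) (Set.Iio (0 : ℝ) ×ˢ Set.univ) →
    (∀ s t : ℝ, s < t → t < 0 → ∀ x, v t x =
      Literature.Analysis.UnboundedOperators.heatExtension (v s) (t - s) x -
        Literature.Analysis.FluidPDE.oseenDuhamel 1 s v v t x) →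
    ∀ s t : ℝ, s < t → t < 0 → ∀ ε : ℝ, 0 < ε → ∃ L₀ : ℝ, 0 < L₀ ∧ ∀ R H : ℝ, L₀ ≤ R → L₀ ≤ H →
      |∫ x in flatBox R H, v t x 2| ≤
        |∫ x in flatBox R H, Literature.Analysis.UnboundedOperators.heatExtension (v s) (t - s) x 2| + ε * (4 * R ^ 2 * H)

/-- **stub Z-oseen** (PROVABLE, L). -/
theorem stub_zeroModeOseen : ZeroModeOseen :=
  fun C v => PoloidalWindowDoorPoloidalWindowRigidityZeroModeOseen.stub_zeroModeOseen C v

/-- **ASSEMBLY `Z ⇐ Z-heat ∧ Z-oseen`** (sorry-free; the «10-line assembly» of price P16-1, in the ORDER of price P16-2): given `t < 0` and `ε > 0`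
choose the past time `s := t − 1 − (2C/ε)²` (so `C/√(−s) ≤ ε/2` — Type-I decay in the PAST, the ancient ingredient), then `L₀ := L₀(s,t,ε/2)` from
Z-oseen; for `R, H ≥ L₀`: `|∫_Q v₂(t)| ≤ |∫_Q heat₂| + (ε/2)|Q| ≤ (C/√(−s))|Q| + (ε/2)|Q| ≤ ε|Q|`. -/
theorem zeroModeLaw_of_heat_of_oseen (hH : ZeroModeHeat) (hO : ZeroModeOseen) : ZeroModeLaw := by
  intro C v hT hc hm t ht ε hε
  set s : ℝ := t - 1 - (2 * C / ε) ^ 2 with hs_def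
  have hsq0 : 0 ≤ (2 * C / ε) ^ 2 := sq_nonneg _
  have hst : s < t := by rw [hs_def]; linarith
  have hs0 : 0 < -s := by rw [hs_def]; linarith
  have hspos : 0 < Real.sqrt (-s) := Real.sqrt_pos.2 hs0
  -- the past time `s` makes the heat part `≤ ε/2`
  have hCs : C / Real.sqrt (-s) ≤ ε / 2 := by
    have h1 : Real.sqrt ((2 * C / ε) ^ 2) ≤ Real.sqrt (-s) :=
      Real.sqrt_le_sqrt (by rw [hs_def]; linarith)
    rw [Real.sqrt_sq_eq_abs] at h1
    have h2 : |2 * C / ε| = 2 * |C| / ε := by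
      rw [abs_div, abs_mul, abs_of_pos hε, abs_of_pos (by norm_num : (0:ℝ) < 2)]
    rw [h2] at h1
    have h3 : 2 * |C| ≤ ε * Real.sqrt (-s) := by
      have := (div_le_iff₀ hε).1 h1
      linarith [this]
    have h4 : C ≤ |C| := le_abs_self C
    rw [div_le_iff₀ hspos]
    nlinarith [h3, h4, hspos.le]
  obtain ⟨L₀, hL₀, hL⟩ := hO C v hT hc hm s t hst ht (ε / 2) (by positivity)
  refine ⟨L₀, hL₀, fun R H hR hH' => ?_⟩
  have hRpos : 0 < R := hL₀.trans_le hR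
  have hHpos : 0 < H := hL₀.trans_le hH'
  have hvol : 0 < 4 * R ^ 2 * H := by positivity
  have h1 := hH C v hT s t hst ht R H hRpos hHpos
  have h2 := hL R H hR hH'
  have h3 : C / Real.sqrt (-s) * (4 * R ^ 2 * H) ≤ ε / 2 * (4 * R ^ 2 * H) :=
    mul_le_mul_of_nonneg_right hCs hvol.le
  calc |∫ x in flatBox R H, v t x 2|
      ≤ |∫ x in flatBox R H, Literature.Analysis.UnboundedOperators.heatExtension (v s) (t - s) x 2| +
          ε / 2 * (4 * R ^ 2 * H) := h2
    _ ≤ ε / 2 * (4 * R ^ 2 * H) + ε / 2 * (4 * R ^ 2 * H) := by linarith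
    _ = ε * (4 * R ^ 2 * H) := by ring

/-- **Z on this line** (⇐ Z-heat ∧ Z-oseen; v1.2: sorry-free, both discharged by name from Theorems). -/
theorem zeroMode_Z : ZeroModeLaw :=
  zeroModeLaw_of_heat_of_oseen stub_zeroModeHeat stub_zeroModeOseen

/-- **F — flux transport** (PROVABLE, S/M).  If the vertical velocity is constant (`= v₂(t,0)`) on the whole plane `P₀` at a time `t < 0`, then
incompressibility transports that value to the flat boxes up to the lateral flux: `|∫_{Q_{R,H}} v₂(t) − v₂(t,0)·4R²H| ≤ M·R·H²` (one may take
`M = 4·C/√(−t)`).  Route: `f(z) := ∫_{[−R,R]²×{z}} v₂(t)`, `f′(z) = ∫ ∂_z v₂ = −∫ (∂₀v₀ + ∂₁v₁) = −∮ v_h·n` (div-free = trace of `fderiv`, then the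
planar divergence theorem `MeasureTheory.integral2_divergence_prod_of_hasFDerivWithinAt_off_countable`), `|f′| ≤ 8R‖v(t)‖_∞`, integrate `z ∈ [0,H]`;
slices are real-analytic, hence `C¹`: tree `…Theorems.PoloidalWindowDoorPoloidalWindowRigidityTypeIAnalytic.typeI_mild_slice_analytic`;
boundedness `bdd_of_hasTypeITimeDecay`. -/
def FluxTransport : Prop :=
  ∀ (C : ℝ) (v : ℝ → EuclideanSpace ℝ (Fin 3) → EuclideanSpace ℝ (Fin 3)),
    Literature.Analysis.FluidPDE.HasTypeITimeDecay C v →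
    ContinuousOn (Function.uncurry v) (Set.Iio (0 : ℝ) ×ˢ Set.univ) →
    (∀ s t : ℝ, s < t → t < 0 → ∀ x, v t x =
      Literature.Analysis.UnboundedOperators.heatExtension (v s) (t - s) x -
        Literature.Analysis.FluidPDE.oseenDuhamel 1 s v v t x) →
    (∀ t < 0, Literature.Analysis.FluidPDE.VectorCalculus.IsDivFree (v t)) →
    ∀ t : ℝ, t < 0 → (∀ y : EuclideanSpace ℝ (Fin 3), y 2 = 0 → v t y 2 = v t 0 2) →
      ∃ M : ℝ, ∀ R H : ℝ, 0 < R → 0 < H →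
        |(∫ x in flatBox R H, v t x 2) - v t 0 2 * (4 * R ^ 2 * H)| ≤ M * R * H ^ 2

/-- **stub F** (PROVABLE, S/M). -/
theorem stub_fluxTransport : FluxTransport :=
  fun C v => PoloidalWindowDoorPoloidalWindowRigidityFluxTransport.stub_fluxTransport C v

/-! ## Kernel: no hot plane -/

/-- **No hot plane** (the statement, unbundled for the probes): in the class, a plane on which the normal velocity is constant at one time carries the
value `0`. -/
def NoHotPlane : Prop :=
  ∀ (C : ℝ) (v : ℝ → EuclideanSpace ℝ (Fin 3) → EuclideanSpace ℝ (Fin 3)),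
    Literature.Analysis.FluidPDE.HasTypeITimeDecay C v →
    ContinuousOn (Function.uncurry v) (Set.Iio (0 : ℝ) ×ˢ Set.univ) →
    (∀ s t : ℝ, s < t → t < 0 → ∀ x, v t x =
      Literature.Analysis.UnboundedOperators.heatExtension (v s) (t - s) x -
        Literature.Analysis.FluidPDE.oseenDuhamel 1 s v v t x) →
    (∀ t < 0, Literature.Analysis.FluidPDE.VectorCalculus.IsDivFree (v t)) →
    ∀ t : ℝ, t < 0 → (∀ y : EuclideanSpace ℝ (Fin 3), y 2 = 0 → v t y 2 = v t 0 2) → v t 0 2 = 0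

/-- **KERNEL `noHotPlane_of_zeroMode_of_flux : Z → F → NoHotPlane`** (sorry-free; real arithmetic).  With `N := v₂(t,0) ≠ 0`, `ε := |N|/4`,
`H := L₀`, `R := max L₀ (|M|·L₀/|N|)`: Z gives `|I| ≤ |N|R²H`, F gives `|I − 4N R²H| ≤ M R H² ≤ |N|R²H`, so `4|N|R²H ≤ 2|N|R²H`, absurd. -/
theorem noHotPlane_of_zeroMode_of_flux (hZ : ZeroModeLaw) (hF : FluxTransport) : NoHotPlane := by
  intro C v hrate hcont hmild hdiv t ht hplane
  by_contra hN
  have hNpos : 0 < |v t 0 2| := abs_pos.mpr hN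
  obtain ⟨L₀, hL₀, hZ'⟩ := hZ C v hrate hcont hmild t ht (|v t 0 2| / 4) (by positivity)
  obtain ⟨M, hM⟩ := hF C v hrate hcont hmild hdiv t ht hplane
  -- the box: height `H = L₀`, half-width `R = max L₀ (|M| L₀ / |N|)`
  set N : ℝ := v t 0 2 with hNdef
  set R : ℝ := max L₀ (|M| * L₀ / |N|) with hRdef
  have hR₁ : L₀ ≤ R := le_max_left _ _
  have hR₂ : |M| * L₀ / |N| ≤ R := le_max_right _ _
  have hRpos : 0 < R := lt_of_lt_of_le hL₀ hR₁
  have h₁ := hZ' R L₀ hR₁ le_rfl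
  have h₂ := hM R L₀ hRpos hL₀
  set I : ℝ := ∫ x in flatBox R L₀, v t x 2 with hIdef
  have hML : |M| * L₀ ≤ |N| * R := by
    have h := (div_le_iff₀ hNpos).mp hR₂
    linarith [h]
  have h₃ : M * R * L₀ ^ 2 ≤ |N| * R ^ 2 * L₀ := by
    calc M * R * L₀ ^ 2 ≤ |M| * R * L₀ ^ 2 := by gcongr; exact le_abs_self M
      _ = (|M| * L₀) * (R * L₀) := by ring
      _ ≤ (|N| * R) * (R * L₀) := by gcongr
      _ = |N| * R ^ 2 * L₀ := by ring
  have h₄ : |N * (4 * R ^ 2 * L₀)| ≤ |I| + |I - N * (4 * R ^ 2 * L₀)| := by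
    calc |N * (4 * R ^ 2 * L₀)| = |I - (I - N * (4 * R ^ 2 * L₀))| := by congr 1; ring
      _ ≤ |I| + |I - N * (4 * R ^ 2 * L₀)| := abs_sub _ _
  have h₅ : |N * (4 * R ^ 2 * L₀)| = |N| * (4 * R ^ 2 * L₀) := by
    rw [abs_mul, abs_of_pos (by positivity : (0 : ℝ) < 4 * R ^ 2 * L₀)]
  have hK : 0 < |N| * (R ^ 2 * L₀) := by positivity
  nlinarith [h₁, h₂, h₃, h₄, h₅, hK]

/-- **No hot plane on this line** (⇐ Z ∧ F). -/
theorem zeroMode_noHotPlane : NoHotPlane :=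
  noHotPlane_of_zeroMode_of_flux zeroMode_Z stub_fluxTransport

/-! ## Cell C1 of hot_split, VERBATIM, proved modulo Z and F -/

/-- **Cell C1 (hot plane ⇒ ∅) — the statement of hot_split's `stub_cellC1`, VERBATIM — from `NoHotPlane`**: a pinned profile has
`N = v₂(−1,0) ≠ 0`, and in cell C1 `v(−1,·)` is constant on `P₀`; `ThickWindow`, `Peakless`, poloidality are not used. -/
theorem cellC1_of_noHotPlane (hNHP : NoHotPlane) :
    ∀ (C : ℝ) (v : ℝ → EuclideanSpace ℝ (Fin 3) → EuclideanSpace ℝ (Fin 3)) (W : Set (ℝ × EuclideanSpace ℝ (Fin 3))),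
      Pinned C v → ThickWindow v W → Peakless v →
      (∀ y : EuclideanSpace ℝ (Fin 3), y 2 = 0 →
        v (-1) y = v (-1) 0 ∧ fderiv ℝ (fun x => v (-1) x 2) y (EuclideanSpace.single 2 1) = 0) →
      False := by
  intro C v W hP _hT _hK hplane
  obtain ⟨hrate, hcont, hmild, hdiv, -, hV, -⟩ := hP
  have hconst : ∀ y : EuclideanSpace ℝ (Fin 3), y 2 = 0 → v (-1) y 2 = v (-1) 0 2 := fun y hy => by
    rw [(hplane y hy).1]
  exact hV (hNHP C v hrate hcont hmild hdiv (-1) (by norm_num) hconst)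

/-- **Cell C1 from Z and F** (kernel). -/
theorem cellC1_of_zeroMode_of_flux (hZ : ZeroModeLaw) (hF : FluxTransport) :
    ∀ (C : ℝ) (v : ℝ → EuclideanSpace ℝ (Fin 3) → EuclideanSpace ℝ (Fin 3)) (W : Set (ℝ × EuclideanSpace ℝ (Fin 3))),
      Pinned C v → ThickWindow v W → Peakless v →
      (∀ y : EuclideanSpace ℝ (Fin 3), y 2 = 0 →
        v (-1) y = v (-1) 0 ∧ fderiv ℝ (fun x => v (-1) x 2) y (EuclideanSpace.single 2 1) = 0) →
      False :=
  cellC1_of_noHotPlane (noHotPlane_of_zeroMode_of_flux hZ hF)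

/-- **hot_split's cell C1 on this line** (⇐ Z ∧ F; v1.2: an unconditional kernel theorem — Z-heat, Z-oseen, F landed). -/
theorem hotSplit_cellC1 :
    ∀ (C : ℝ) (v : ℝ → EuclideanSpace ℝ (Fin 3) → EuclideanSpace ℝ (Fin 3)) (W : Set (ℝ × EuclideanSpace ℝ (Fin 3))),
      Pinned C v → ThickWindow v W → Peakless v →
      (∀ y : EuclideanSpace ℝ (Fin 3), y 2 = 0 →
        v (-1) y = v (-1) 0 ∧ fderiv ℝ (fun x => v (-1) x 2) y (EuclideanSpace.single 2 1) = 0) →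
      False :=
  cellC1_of_noHotPlane zeroMode_noHotPlane


/-! ## The three cells (C1 CLOSED in v1.3; C2a, C2b OPEN; research; each refutable by one pinned profile of its type) -/

/-- **Cell C1 `stub_cellC1` — HOT PLANE ⇒ ∅ (OPEN).**  A pinned, thick, peakless profile whose time-`−1` slice is constant on the hot-spot plane
(`v(−1,·)|_{P₀} ≡ (b, N)`, by A1) does not exist.  Why it might fail: no sign/maximum principle is known for the plane's shear potential `α`
(`σΔₕα ≥ 0`, no closed level curves) beyond subharmonicity; half-space analogies hold at one time only.  Census §C1. -/
theorem stub_cellC1 :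
    ∀ (C : ℝ) (v : ℝ → EuclideanSpace ℝ (Fin 3) → EuclideanSpace ℝ (Fin 3)) (W : Set (ℝ × EuclideanSpace ℝ (Fin 3))),
      Pinned C v → ThickWindow v W → Peakless v →
      (∀ y : EuclideanSpace ℝ (Fin 3), y 2 = 0 →
        v (-1) y = v (-1) 0 ∧ fderiv ℝ (fun x => v (-1) x 2) y (EuclideanSpace.single 2 1) = 0) →
      False :=
  cellC1_of_noHotPlane zeroMode_noHotPlane

/-! ## v1.4 — THE M-SIZED INTERIOR OF THE RIDGE CELLS (critic idea-crit-7 g5, C2a SIZING 01:27:47Z): reductions R1–R4 (hand targets,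
stated ONCE for both cells) and the residues C2a′ `stub_cellC2aRidge` / C2b′ `stub_cellC2bRidge` (OPEN research); `stub_cellC2a` / `stub_cellC2b`
keep their v1.2 statements byte-for-byte and become DERIVED from the kernels `cellC2a_of_reductions` / `cellC2b_of_reductions` (sorry-free). -/

/-- The HOT SET of the hot-spot plane `P₀ = {y₂ = 0}` at time `−1`: `H := {y : y₂ = 0, v₂(−1,y) = v₂(−1,0)}` (`0 ∈ H`). -/
def hotSet (v : ℝ → EuclideanSpace ℝ (Fin 3) → EuclideanSpace ℝ (Fin 3)) : Set (EuclideanSpace ℝ (Fin 3)) :=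
  {y | y 2 = 0 ∧ v (-1) y 2 = v (-1) 0 2}

/-- **R1 `HotSetClosedCritical` (S; hand target).**  In the pinned class the hot set `H` is CLOSED (continuity of the slice `v(−1,·)`, from the
`ContinuousOn` conjunct of `Pinned`) and every hot point is a CRITICAL point of `v₂(−1,·)`: `fderiv (v₂(−1,·)) y = 0` (Fermat from the global bound
`√(−t)|v₂| ≤ |N|` at `t = −1`, tree `…LoopTangencyPin.fderiv_eq_zero_of_abs_le`, differentiability from `…TypeIAnalytic.typeI_mild_slice_analytic` —
exactly as in the landed `…HotPlaneConst`). -/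
def HotSetClosedCritical : Prop :=
  ∀ (C : ℝ) (v : ℝ → EuclideanSpace ℝ (Fin 3) → EuclideanSpace ℝ (Fin 3)), Pinned C v →
    IsClosed (hotSet v) ∧ ∀ y ∈ hotSet v, fderiv ℝ (fun x => v (-1) x 2) y = 0

/-- **R2 `VortexLineHot` (M; hand target) — the vortex line through a hot point is a hot curve of `P₀`.**  Pinned class + the frozen law
`⟪Dv(s)_y ω(s,y), e₃⟫ = 0` (landed `…FirstIntegral.stub_firstIntegral`, supplied by name in `peaklessEmpty_of_split`): through every hot point `y₀` there
is a local integral curve `γ : (−ε, ε) → ℝ³` of `ω(−1,·) = curl v(−1)` with `γ 0 = y₀` (Picard–Lindelöf, Mathlib `exists_forall_hasDerivAt_Ioo_eq_of_contDiffAt`;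
`v(−1)` is real-analytic by `…TypeIAnalytic.typeI_mild_slice_analytic`, so `curl v(−1)` is `C¹`), and it STAYS IN `H`: `d/dτ (γ τ)₂ = ω₂(γ τ) = 0`
(poloidal conjunct of `Pinned`) and `d/dτ v₂(−1, γ τ) = ⟪Dv(−1)_{γτ} ω, e₃⟫ = 0` (frozen law), integrated by `…LoopTangencyPin.apply_integralCurve_eq`. -/
def VortexLineHot : Prop :=
  ∀ (C : ℝ) (v : ℝ → EuclideanSpace ℝ (Fin 3) → EuclideanSpace ℝ (Fin 3)), Pinned C v →
    (∀ s < 0, ∀ y, ⟪fderiv ℝ (v s) y (Literature.Analysis.FluidPDE.curl (v s) y), EuclideanSpace.single 2 1⟫_ℝ = 0) →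
    ∀ y₀ ∈ hotSet v, ∃ (γ : ℝ → EuclideanSpace ℝ (Fin 3)) (ε : ℝ), 0 < ε ∧ γ 0 = y₀ ∧
      ∀ τ ∈ Set.Ioo (-ε) ε, HasDerivAt γ (Literature.Analysis.FluidPDE.curl (v (-1)) (γ τ)) τ ∧ γ τ ∈ hotSet v

/-- **R3 `NoCompactIsolatedHotPiece` (S; hand target) — pure unpacking of `Peakless` at `(s, z₀, σ, M) = (−1, 0, sign N, |N|)`:** the global bound
`|v₂(−1,·)| ≤ |N|` (the `t = −1` instance of the `Pinned` bound, `√1 = 1`) is the guard inequality `σv₂ ≤ M` on ALL of `P₀`, a subset `K ⊆ H` has `σv₂ = σN = |N|`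
on it, and a point of `O ∩ P₀` with `σv₂ = |N|` is hot; so NO compact nonempty `K ⊆ H` is cut out of `H` by an open `O ⊇ K` (`O ∩ H ⊆ K`).  In particular
`H` has no isolated point, no isolated compact component, no isolated closed hot loop or hot arc. -/
def NoCompactIsolatedHotPiece : Prop :=
  ∀ (C : ℝ) (v : ℝ → EuclideanSpace ℝ (Fin 3) → EuclideanSpace ℝ (Fin 3)), Pinned C v → Peakless v →
    ∀ K O : Set (EuclideanSpace ℝ (Fin 3)), IsCompact K → K.Nonempty → K ⊆ hotSet v → IsOpen O → K ⊆ O →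
      O ∩ hotSet v ⊆ K → False

/-- **R4 `HotSetNoInterior` (M; hand target) — one non-hot point of `P₀` makes `H` nowhere dense in `P₀`:** if `v₂(−1,·) = N` on a planar disc
`{y₂ = 0, dist(y′,y) < r}` then `a ↦ v₂(−1,(a₀,a₁,0)) − N`, real-analytic on `ℝ²` (`…TypeIAnalytic.typeI_mild_slice_analytic` composed with the affine
chart of `P₀`, as in `…DiscDichotomy` step (2) / `…LayeredNoLoop`), vanishes on an open set, hence on all of `ℝ²` (identity theorem) — contradicting the
non-hot point.  Stated pointwise: every hot point is a limit of non-hot points of `P₀`. -/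
def HotSetNoInterior : Prop :=
  ∀ (C : ℝ) (v : ℝ → EuclideanSpace ℝ (Fin 3) → EuclideanSpace ℝ (Fin 3)), Pinned C v →
    (∃ y : EuclideanSpace ℝ (Fin 3), y 2 = 0 ∧ v (-1) y 2 ≠ v (-1) 0 2) →
    ∀ y ∈ hotSet v, ∀ r : ℝ, 0 < r →
      ∃ y' : EuclideanSpace ℝ (Fin 3), y' 2 = 0 ∧ dist y' y < r ∧ v (-1) y' 2 ≠ v (-1) 0 2

section RProofs

open Filter Topology Metric
open PoloidalWindowDoorPoloidalWindowRigidityWindow PoloidalWindowDoorPoloidalWindowRigidityFirstIntegral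
open PoloidalWindowDoorPoloidalWindowRigidityLoopTangencyPin PoloidalWindowDoorPoloidalWindowRigidityDiscDichotomy

/-- Smoothness package of the slice `v(−1)` in the pinned class. -/
theorem slice_facts {C : ℝ} {v : ℝ → EuclideanSpace ℝ (Fin 3) → EuclideanSpace ℝ (Fin 3)} (hP : Pinned C v) :
    IsTypeIAncientMild C v ∧ ContDiff ℝ 2 (v (-1)) ∧ (∀ y, |v (-1) y 2| ≤ |v (-1) 0 2|) ∧
      (∀ y, curl (v (-1)) y 2 = 0) := by
  obtain ⟨hrate, hcont, hmild, hdiv, hpol, _, hsup, -, -⟩ := hP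
  have hA : IsTypeIAncientMild C v := isTypeIAncientMild_of_class hrate hcont hmild hdiv
  have hvs : ContDiff ℝ (⊤ : ℕ∞) (v (-1)) := hA.contDiff_slice (by norm_num)
  have hv2 : ContDiff ℝ 2 (v (-1)) := contDiff_infty.1 hvs 2
  refine ⟨hA, hv2, fun y => ?_, fun y => ?_⟩
  · have h := hsup (-1) (by norm_num) y
    simpa using h
  · have h := hpol (-1) (by norm_num) y
    simpa [EuclideanSpace.inner_single_right] using h

/-- **R1 — PROVED in the workfile (v1.4.1)**: closedness by continuity of the slice, criticality by Fermat
(`…LoopTangencyPin.fderiv_eq_zero_of_abs_le`). -/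
theorem stub_hotSetClosedCritical : HotSetClosedCritical := by
  intro C v hP
  obtain ⟨hA, hv2, hext, -⟩ := slice_facts hP
  have hwcont : Continuous fun y => v (-1) y 2 := (contDiff_apply_coord_vec3 hv2 2).continuous
  have hcoord : Continuous fun y : EuclideanSpace ℝ (Fin 3) => y 2 := by
    simpa using (EuclideanSpace.proj (𝕜 := ℝ) (2 : Fin 3)).continuous
  refine ⟨?_, ?_⟩
  · have h1 : IsClosed {y : EuclideanSpace ℝ (Fin 3) | y 2 = 0} := isClosed_eq hcoord continuous_const
    have h2 : IsClosed {y : EuclideanSpace ℝ (Fin 3) | v (-1) y 2 = v (-1) 0 2} :=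
      isClosed_eq hwcont continuous_const
    have h12 := h1.inter h2
    have hset : hotSet v = {y : EuclideanSpace ℝ (Fin 3) | y 2 = 0} ∩ {y | v (-1) y 2 = v (-1) 0 2} := by
      ext y; simp [hotSet]
    rw [hset]; exact h12
  · intro y hy
    have hle : ∀ z, |(fun x => v (-1) x 2) z| ≤ |(fun x => v (-1) x 2) y| := fun z => by
      simp only [hy.2]; exact hext z
    exact fderiv_eq_zero_of_abs_le hle

/-- **R2 — PROVED in the workfile (v1.4.1)**: Picard–Lindelöf for the `C¹` field `curl v(−1)` (Mathlib
`ContDiffAt.exists_forall_mem_closedBall_exists_eq_forall_mem_Ioo_hasDerivAt₀`), then `(γ τ)₂` and `v₂(−1, γ τ)` are first integrals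
(`…LoopTangencyPin.apply_integralCurve_eq`; poloidality and the frozen law) — the template is the landed `…LoopTangencyPin.stub_loopTangencyPin`. -/
theorem stub_vortexLineHot : VortexLineHot := by
  intro C v hP hFL y₀ hy₀
  obtain ⟨hA, hv2, hext, hpol1⟩ := slice_facts hP
  have hω1 : ContDiff ℝ 1 (curl (v (-1))) := contDiff_curl (n := 1) (by exact_mod_cast hv2)
  have hvd : Differentiable ℝ (v (-1)) := hv2.differentiable two_ne_zero
  have hfrozen : ∀ y, fderiv ℝ (v (-1)) y (curl (v (-1)) y) 2 = 0 := fun y => by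
    have h := hFL (-1) (by norm_num) y
    simpa [EuclideanSpace.inner_single_right] using h
  obtain ⟨c, hc0, ε, hε, hc⟩ :=
    (hω1.contDiffAt (x := y₀)).exists_forall_mem_closedBall_exists_eq_forall_mem_Ioo_hasDerivAt₀ 0
  have hc' : ∀ t ∈ Ioo (-ε) ε, HasDerivAt c (curl (v (-1)) (c t)) t := fun t ht =>
    hc t (by simpa using ht)
  refine ⟨c, ε, hε, hc0, fun τ hτ => ⟨hc' τ hτ, ?_, ?_⟩⟩
  · -- the curve stays in the plane `{y₂ = 0}`
    have hφ : Differentiable ℝ (⇑(EuclideanSpace.proj (𝕜 := ℝ) (2 : Fin 3))) :=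
      (EuclideanSpace.proj (𝕜 := ℝ) (2 : Fin 3)).differentiable
    have hφX : ∀ y, fderiv ℝ (⇑(EuclideanSpace.proj (𝕜 := ℝ) (2 : Fin 3))) y (curl (v (-1)) y) = 0 :=
      fun y => by
        rw [(EuclideanSpace.proj (𝕜 := ℝ) (2 : Fin 3)).fderiv]
        simpa using hpol1 y
    have h := apply_integralCurve_eq hc' hφ hφX hτ
    rw [hc0] at h
    have h' : c τ 2 = y₀ 2 := by simpa using h
    rw [h']; exact hy₀.1
  · -- `v₂(−1,·)` is constant along the curve
    have hφ : Differentiable ℝ (fun y => v (-1) y 2) :=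
      (contDiff_apply_coord_vec3 hv2 2).differentiable two_ne_zero
    have hφX : ∀ y, fderiv ℝ (fun y => v (-1) y 2) y (curl (v (-1)) y) = 0 := fun y => by
      rw [fderiv_apply_coord_vec3 (hvd y) 2]
      exact hfrozen y
    have h := apply_integralCurve_eq hc' hφ hφX hτ
    rw [hc0] at h
    rw [h]; exact hy₀.2

/-- **R3 — PROVED in the workfile (v1.4.1)**: `Peakless` at `(−1, 0, σ, |N|)` with `σN = |N|`. -/
theorem stub_noCompactIsolatedHotPiece : NoCompactIsolatedHotPiece := by
  intro C v hP hPk K O hK hKne hKH hO hKO hOH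
  obtain ⟨-, -, hext, -⟩ := slice_facts hP
  obtain ⟨-, -, -, -, -, hN, -, -, -⟩ := hP
  set N := v (-1) 0 2 with hNdef
  -- the sign `σ` with `σ N = |N|`
  obtain ⟨σ, hσ1, hσN⟩ : ∃ σ : ℝ, (σ = 1 ∨ σ = -1) ∧ σ * N = |N| := by
    rcases le_or_gt 0 N with h | h
    · exact ⟨1, Or.inl rfl, by rw [one_mul, abs_of_nonneg h]⟩
    · exact ⟨-1, Or.inr rfl, by rw [abs_of_neg h]; ring⟩
  have hσne : σ ≠ 0 := by rcases hσ1 with h | h <;> simp [h]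
  have hσabs : ∀ a : ℝ, σ * a ≤ |a| := fun a => by
    rcases hσ1 with h | h
    · rw [h, one_mul]; exact le_abs_self a
    · rw [h, neg_one_mul]; exact neg_le_abs a
  apply hPk (-1) 0 σ |N| K O (by norm_num)
  refine ⟨hσ1, hK, hKne, ?_, hO, hKO, ?_, ?_⟩
  · intro y hy
    obtain ⟨hy0, hyN⟩ := hKH hy
    exact ⟨hy0, by rw [hyN, hσN]⟩
  · intro y _ _
    exact (hσabs _).trans (hext y)
  · intro y hyO hy0 hyM
    apply hOH
    refine ⟨hyO, hy0, ?_⟩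
    have h : σ * v (-1) y 2 = σ * N := by rw [hyM, hσN]
    exact mul_left_cancel₀ hσne h

/-- **R4 — PROVED in the workfile (v1.4.1)**: the planar identity theorem `…DiscDichotomy.eq_const_on_plane_of_analytic` on the disc
`ball y r ∩ P₀`, analyticity from `IsTypeIAncientMild.analyticOnNhd_slice_univ`. -/
theorem stub_hotSetNoInterior : HotSetNoInterior := by
  intro C v hP hnon y hy r hr
  obtain ⟨hA, hv2, -, -⟩ := slice_facts hP
  have hwan : AnalyticOnNhd ℝ (fun y => v (-1) y 2) univ := fun y _ =>
    ((EuclideanSpace.proj (𝕜 := ℝ) (2 : Fin 3)).analyticAt _).comp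
      (hA.analyticOnNhd_slice_univ (by norm_num) y (mem_univ _))
  by_contra hcon
  push_neg at hcon
  -- `v₂(−1,·) = N` on the planar disc `ball y r ∩ P₀`
  have hc : ∀ y' ∈ ball y r, y' 2 = 0 → v (-1) y' 2 = v (-1) 0 2 := fun y' hy' hy'0 =>
    hcon y' hy'0 (mem_ball.1 hy')
  have hall := eq_const_on_plane_of_analytic hwan isOpen_ball ⟨y, mem_ball_self hr, hy.1⟩ hc
  obtain ⟨y₁, hy₁0, hy₁N⟩ := hnon
  exact hy₁N (hall y₁ hy₁0)

/-- **R5 `HotComponentUnbounded` (v1.5, PROVED below)** — every connected component of the hot set is UNBOUNDED (Šura-Bura: a bounded component of the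
closed set `H` would be cut out of `H` by a compact relatively-clopen piece, which R3 = `Peakless` forbids). -/
def HotComponentUnbounded : Prop :=
  ∀ (C : ℝ) (v : ℝ → EuclideanSpace ℝ (Fin 3) → EuclideanSpace ℝ (Fin 3)), Pinned C v → Peakless v →
    ∀ y ∈ hotSet v, ¬ Bornology.IsBounded (connectedComponentIn (hotSet v) y)

/-- Topological core (Šura-Bura in `ℝ³`): a closed set none of whose nonempty compact subsets is relatively clopen has only unbounded components. -/
theorem not_isBounded_connectedComponentIn {H : Set (EuclideanSpace ℝ (Fin 3))} (hH : IsClosed H)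
    (hno : ∀ K O : Set (EuclideanSpace ℝ (Fin 3)), IsCompact K → K.Nonempty → K ⊆ H → IsOpen O → K ⊆ O →
      O ∩ H ⊆ K → False)
    {y₀ : EuclideanSpace ℝ (Fin 3)} (hy₀ : y₀ ∈ H) :
    ¬ Bornology.IsBounded (connectedComponentIn H y₀) := by
  intro hbdd
  -- a ball containing the component
  obtain ⟨R, hR⟩ := (Metric.isBounded_iff_subset_ball (0 : EuclideanSpace ℝ (Fin 3))).1 hbdd
  -- the compact Hausdorff space `X = H ∩ closedBall 0 (R+1)`
  set B : Set (EuclideanSpace ℝ (Fin 3)) := closedBall 0 (R + 1) with hB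
  have hXc : IsCompact (H ∩ B) := (isCompact_closedBall _ _).inter_left hH
  haveI : CompactSpace ↥(H ∩ B) := isCompact_iff_compactSpace.1 hXc
  have hy₀S : y₀ ∈ connectedComponentIn H y₀ := mem_connectedComponentIn hy₀
  have hy₀R : y₀ ∈ ball (0 : EuclideanSpace ℝ (Fin 3)) R := hR hy₀S
  have hy₀B : y₀ ∈ B := by
    rw [hB]; exact mem_closedBall.2 (by have := mem_ball.1 hy₀R; linarith)
  set x₀ : ↥(H ∩ B) := ⟨y₀, hy₀, hy₀B⟩ with hx₀
  -- the component of `x₀` in `X` maps into the component of `y₀` in `H`, hence into `ball 0 R`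
  have himg : ((↑) : ↥(H ∩ B) → EuclideanSpace ℝ (Fin 3)) '' connectedComponent x₀ ⊆ connectedComponentIn H y₀ := by
    refine IsPreconnected.subset_connectedComponentIn ?_ ?_ ?_
    · exact isPreconnected_connectedComponent.image _ continuous_subtype_val.continuousOn
    · exact ⟨x₀, mem_connectedComponent, rfl⟩
    · rintro z ⟨w, -, rfl⟩; exact w.2.1
  -- the open set `U = X ∩ ball 0 (R + 1/2)` contains the component
  set U : Set ↥(H ∩ B) := ((↑) : ↥(H ∩ B) → EuclideanSpace ℝ (Fin 3)) ⁻¹' ball 0 (R + 1/2) with hU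
  have hUo : IsOpen U := isOpen_ball.preimage continuous_subtype_val
  have hCU : connectedComponent x₀ ⊆ U := by
    intro w hw
    have : (w : EuclideanSpace ℝ (Fin 3)) ∈ ball (0 : EuclideanSpace ℝ (Fin 3)) R := hR (himg ⟨w, hw, rfl⟩)
    show (w : EuclideanSpace ℝ (Fin 3)) ∈ ball (0 : EuclideanSpace ℝ (Fin 3)) (R + 1/2)
    exact mem_ball.2 (by have := mem_ball.1 this; linarith)
  -- Šura-Bura: a clopen `W` of `X` with `component ⊆ W ⊆ U`
  have hF : IsCompact Uᶜ := hUo.isClosed_compl.isCompact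
  have hinter : Uᶜ ∩ ⋂ Z : {Z : Set ↥(H ∩ B) // IsClopen Z ∧ x₀ ∈ Z}, (Z : Set ↥(H ∩ B)) = ∅ := by
    rw [← connectedComponent_eq_iInter_isClopen x₀]
    ext w; constructor
    · rintro ⟨hwU, hwC⟩; exact hwU (hCU hwC)
    · intro h; exact h.elim
  obtain ⟨t, ht⟩ := hF.elim_finite_subfamily_closed
    (fun Z : {Z : Set ↥(H ∩ B) // IsClopen Z ∧ x₀ ∈ Z} => (Z : Set ↥(H ∩ B))) (fun Z => Z.2.1.1) hinter
  set W : Set ↥(H ∩ B) := ⋂ Z ∈ t, (Z : Set ↥(H ∩ B)) with hW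
  have hWclopen : IsClopen W := isClopen_biInter_finset (fun Z _ => Z.2.1)
  have hx₀W : x₀ ∈ W := by
    rw [hW]; exact mem_iInter₂.2 (fun Z _ => Z.2.2)
  have hWU : W ⊆ U := by
    intro w hw
    by_contra hwU
    have : w ∈ Uᶜ ∩ ⋂ Z ∈ t, (Z : Set ↥(H ∩ B)) := ⟨hwU, hw⟩
    rw [ht] at this; exact this
  -- transport to `ℝ³`
  obtain ⟨O₁, hO₁, hO₁W⟩ := isOpen_induced_iff.1 hWclopen.isOpen
  set K : Set (EuclideanSpace ℝ (Fin 3)) := ((↑) : ↥(H ∩ B) → EuclideanSpace ℝ (Fin 3)) '' W with hK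
  have hKc : IsCompact K := hWclopen.isClosed.isCompact.image continuous_subtype_val
  have hKne : K.Nonempty := ⟨y₀, ⟨x₀, hx₀W, rfl⟩⟩
  have hKH : K ⊆ H := by rintro z ⟨w, -, rfl⟩; exact w.2.1
  refine hno K (O₁ ∩ ball 0 (R + 1/2)) hKc hKne hKH (hO₁.inter isOpen_ball) ?_ ?_
  · rintro z ⟨w, hw, rfl⟩
    refine ⟨?_, hWU hw⟩
    have : w ∈ ((↑) : ↥(H ∩ B) → EuclideanSpace ℝ (Fin 3)) ⁻¹' O₁ := by rw [hO₁W]; exact hw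
    exact this
  · rintro z ⟨⟨hzO, hzball⟩, hzH⟩
    have hzB : z ∈ B := by
      rw [hB]; exact mem_closedBall.2 (by have := mem_ball.1 hzball; linarith)
    refine ⟨⟨z, hzH, hzB⟩, ?_, rfl⟩
    have : (⟨z, hzH, hzB⟩ : ↥(H ∩ B)) ∈ ((↑) : ↥(H ∩ B) → EuclideanSpace ℝ (Fin 3)) ⁻¹' O₁ := hzO
    rw [hO₁W] at this; exact this

/-- **R5 — PROVED (v1.5): in the pinned peakless class every connected component of the hot set `H ⊂ P₀` is UNBOUNDED.**  This is the typed
content the tree's `…HotLoopsPeakless` (conditional on the wall) explicitly did NOT claim («every component of `Hot` is unbounded»); here it is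
unconditional inside HL3′ (hypothesis `Peakless`, no wall), from R1 (closed) + R3 (no compact relatively-clopen piece) + Šura-Bura.  Consequence for
the residues: the hot ridge of C2a′ / C2b′ through the hot spot REACHES INFINITY — the «bounded, accumulating» alternative of the census is dead. -/
theorem hotComponent_unbounded : HotComponentUnbounded := by
  intro C v hP hPk y hy
  exact not_isBounded_connectedComponentIn (stub_hotSetClosedCritical C v hP).1 (stub_noCompactIsolatedHotPiece C v hP hPk) hy

/-- In particular the component of the HOT SPOT `0 ∈ H` is unbounded: `H` contains an unbounded connected closed set through `0`. -/
theorem hotSpot_component_unbounded {C : ℝ} {v : ℝ → EuclideanSpace ℝ (Fin 3) → EuclideanSpace ℝ (Fin 3)}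
    (hP : Pinned C v) (hPk : Peakless v) :
    ¬ Bornology.IsBounded (connectedComponentIn (hotSet v) 0) :=
  hotComponent_unbounded C v hP hPk 0 ⟨rfl, rfl⟩

/-- **R6 `hot_meets_every_circle` (v1.6, PROVED)** — the hot set meets EVERY circle of `P₀` centred at the hot spot: for each `R ≥ 0` there is a hot point
`y` with `‖y‖ = R` (the component of `0` in `H` is connected, contains `0`, and is unbounded (R5); the norm takes every value on it). -/
theorem hot_meets_every_circle {C : ℝ} {v : ℝ → EuclideanSpace ℝ (Fin 3) → EuclideanSpace ℝ (Fin 3)}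
    (hP : Pinned C v) (hPk : Peakless v) (R : ℝ) (hR : 0 ≤ R) :
    ∃ y ∈ hotSet v, ‖y‖ = R := by
  have h0 : (0 : EuclideanSpace ℝ (Fin 3)) ∈ hotSet v := ⟨rfl, rfl⟩
  set S := connectedComponentIn (hotSet v) (0 : EuclideanSpace ℝ (Fin 3)) with hS
  have hunb : ¬ Bornology.IsBounded S := hotComponent_unbounded C v hP hPk 0 h0
  -- a point of the component with norm `> R`
  obtain ⟨z, hzS, hzR⟩ : ∃ z ∈ S, R < ‖z‖ := by
    by_contra h
    push_neg at h
    apply hunb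
    refine (Metric.isBounded_iff_subset_closedBall (0 : EuclideanSpace ℝ (Fin 3))).2 ⟨R, fun z hz => ?_⟩
    rw [mem_closedBall, dist_zero_right]; exact h z hz
  -- intermediate value of the norm on the preconnected `S` between `0` and `z`
  have hpre : IsPreconnected S := isPreconnected_connectedComponentIn
  have h0S : (0 : EuclideanSpace ℝ (Fin 3)) ∈ S := mem_connectedComponentIn h0
  have hIcc := hpre.intermediate_value h0S hzS (continuous_norm.continuousOn)
  have hRmem : R ∈ Icc ‖(0 : EuclideanSpace ℝ (Fin 3))‖ ‖z‖ := by
    rw [norm_zero]; exact ⟨hR, hzR.le⟩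
  obtain ⟨y, hyS, hyR⟩ := hIcc hRmem
  exact ⟨y, connectedComponentIn_subset _ _ hyS, hyR⟩


/-- **R7 `planarArgmax_component_unbounded` (v1.6, PROVED)** — NO BOUNDED PLANAR EXTREMAL COMPONENTS, ANY PLANE, ANY TIME: in the pinned peakless class, if
`σ·v₂(s,·)` (`σ = ±1`, `s < 0`) attains its maximum over the horizontal plane `P_{z₀}` at `y₀`, then the connected component of `y₀` in the planar
argmax set `{y ∈ P_{z₀} : v₂(s,y) = v₂(s,y₀)}` is UNBOUNDED.  (R5 is the case `s = −1`, `z₀ = 0`, level `N`.) -/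
theorem planarArgmax_component_unbounded {C : ℝ} {v : ℝ → EuclideanSpace ℝ (Fin 3) → EuclideanSpace ℝ (Fin 3)}
    (hP : Pinned C v) (hPk : Peakless v) {s z₀ σ : ℝ} (hs : s < 0) (hσ : σ = 1 ∨ σ = -1)
    {y₀ : EuclideanSpace ℝ (Fin 3)} (hy₀ : y₀ 2 = z₀) (hmax : ∀ y : EuclideanSpace ℝ (Fin 3), y 2 = z₀ → σ * v s y 2 ≤ σ * v s y₀ 2) :
    ¬ Bornology.IsBounded (connectedComponentIn {y : EuclideanSpace ℝ (Fin 3) | y 2 = z₀ ∧ v s y 2 = v s y₀ 2} y₀) := by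
  obtain ⟨hrate, hcont, hmild, hdiv, -, -, -, -, -⟩ := hP
  have hA : IsTypeIAncientMild C v := isTypeIAncientMild_of_class hrate hcont hmild hdiv
  have hvs : ContDiff ℝ (⊤ : ℕ∞) (v s) := hA.contDiff_slice hs
  have hv2 : ContDiff ℝ 2 (v s) := contDiff_infty.1 hvs 2
  have hwcont : Continuous fun y => v s y 2 := (contDiff_apply_coord_vec3 hv2 2).continuous
  have hcoord : Continuous fun y : EuclideanSpace ℝ (Fin 3) => y 2 := by
    simpa using (EuclideanSpace.proj (𝕜 := ℝ) (2 : Fin 3)).continuous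
  set H : Set (EuclideanSpace ℝ (Fin 3)) := {y | y 2 = z₀ ∧ v s y 2 = v s y₀ 2} with hH
  have hHc : IsClosed H := by
    have h1 : IsClosed {y : EuclideanSpace ℝ (Fin 3) | y 2 = z₀} := isClosed_eq hcoord continuous_const
    have h2 : IsClosed {y : EuclideanSpace ℝ (Fin 3) | v s y 2 = v s y₀ 2} := isClosed_eq hwcont continuous_const
    have hset : H = {y : EuclideanSpace ℝ (Fin 3) | y 2 = z₀} ∩ {y | v s y 2 = v s y₀ 2} := by
      ext y; simp [hH]
    rw [hset]; exact h1.inter h2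
  have hσne : σ ≠ 0 := by rcases hσ with h | h <;> simp [h]
  have hno : ∀ K O : Set (EuclideanSpace ℝ (Fin 3)), IsCompact K → K.Nonempty → K ⊆ H → IsOpen O → K ⊆ O →
      O ∩ H ⊆ K → False := by
    intro K O hK hKne hKH hO hKO hOH
    apply hPk s z₀ σ (σ * v s y₀ 2) K O hs
    refine ⟨hσ, hK, hKne, ?_, hO, hKO, ?_, ?_⟩
    · intro y hy
      obtain ⟨hy1, hy2⟩ := hKH hy
      exact ⟨hy1, by rw [hy2]⟩
    · intro y _ hyz
      exact hmax y hyz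
    · intro y hyO hyz hyM
      apply hOH
      exact ⟨hyO, hyz, mul_left_cancel₀ hσne hyM⟩
  exact not_isBounded_connectedComponentIn hHc hno ⟨hy₀, rfl⟩




end RProofs

/-- **Residue C2a′ `stub_cellC2aRidge` — THE UNBOUNDED / ACCUMULATING HOT VORTEX RIDGE ⇒ ∅ (OPEN, research; census row C2).**  The pinned, thick,
peakless class with the frozen law, WITH the conclusions of R1–R4 in hand — `H` closed and critical, no compact isolated hot piece (so the maximal hot
vortex curve below is NOT contained in any compact isolated component of `H`: it is unbounded or accumulates on further hot structure), `H` nowhere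
dense in `P₀` — and a NON-STATIONARY HOT VORTEX CURVE: a local integral curve `γ` of `ω(−1,·)` inside `H` with `ω(−1, γ 0) ≠ 0`.  Why it might fail /
why open: every LOCAL attack is census-dead (finite-jet barrier, rows C1–C6 of `hot_loops-HL3-census.md`); every LARGE-SCALE law of the class is blind
to a codimension-2 hot set (CENSUS-C2-g8 B-g8-2/4); the Harnack sketch has the wrong sign (B-g8-5); a kill must be GLOBAL ∧ ANCIENT along the ridge —
none is known.  Equivalent to C2a given R1–R4 (`cellC2a_of_reductions` below and the trivial converse). -/
theorem stub_cellC2aRidge :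
    ∀ (C : ℝ) (v : ℝ → EuclideanSpace ℝ (Fin 3) → EuclideanSpace ℝ (Fin 3)) (W : Set (ℝ × EuclideanSpace ℝ (Fin 3))),
      Pinned C v → ThickWindow v W → Peakless v →
      (∀ s < 0, ∀ y, ⟪fderiv ℝ (v s) y (Literature.Analysis.FluidPDE.curl (v s) y), EuclideanSpace.single 2 1⟫_ℝ = 0) →
      IsClosed (hotSet v) → (∀ y ∈ hotSet v, fderiv ℝ (fun x => v (-1) x 2) y = 0) →
      (∀ K O : Set (EuclideanSpace ℝ (Fin 3)), IsCompact K → K.Nonempty → K ⊆ hotSet v → IsOpen O → K ⊆ O →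
        O ∩ hotSet v ⊆ K → False) →
      (∀ y ∈ hotSet v, ∀ r : ℝ, 0 < r →
        ∃ y' : EuclideanSpace ℝ (Fin 3), y' 2 = 0 ∧ dist y' y < r ∧ v (-1) y' 2 ≠ v (-1) 0 2) →
      (∃ (γ : ℝ → EuclideanSpace ℝ (Fin 3)) (ε : ℝ), 0 < ε ∧ γ 0 ∈ hotSet v ∧
        Literature.Analysis.FluidPDE.curl (v (-1)) (γ 0) ≠ 0 ∧
        ∀ τ ∈ Set.Ioo (-ε) ε, HasDerivAt γ (Literature.Analysis.FluidPDE.curl (v (-1)) (γ τ)) τ ∧ γ τ ∈ hotSet v) →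
      False := by
  sorry

/-- **Residue C2b′ `stub_cellC2bRidge` — THE NULL RIDGE ⇒ ∅ (OPEN, research; census row C2, thread-zero structure).**  As C2a′ with, instead of the
hot vortex curve, «every hot point is a vorticity zero» (so `H ∖ {isolated points}` — and by R3 `H` has no isolated points — is a closed, nowhere
dense, perfect set of common zeros of `ω(−1,·)|_{P₀}` and of `∇v₂(−1,·)`, unbounded or accumulating).  Why open: as C2a′ (local attacks census-dead;
large-scale laws blind; the analytic-set structure of `H` moves the cell inside itself only, CENSUS-C2-g8 S-g8-4).  Equivalent to C2b given R1, R3, R4. -/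
theorem stub_cellC2bRidge :
    ∀ (C : ℝ) (v : ℝ → EuclideanSpace ℝ (Fin 3) → EuclideanSpace ℝ (Fin 3)) (W : Set (ℝ × EuclideanSpace ℝ (Fin 3))),
      Pinned C v → ThickWindow v W → Peakless v →
      (∀ s < 0, ∀ y, ⟪fderiv ℝ (v s) y (Literature.Analysis.FluidPDE.curl (v s) y), EuclideanSpace.single 2 1⟫_ℝ = 0) →
      IsClosed (hotSet v) → (∀ y ∈ hotSet v, fderiv ℝ (fun x => v (-1) x 2) y = 0) →
      (∀ K O : Set (EuclideanSpace ℝ (Fin 3)), IsCompact K → K.Nonempty → K ⊆ hotSet v → IsOpen O → K ⊆ O →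
        O ∩ hotSet v ⊆ K → False) →
      (∀ y ∈ hotSet v, ∀ r : ℝ, 0 < r →
        ∃ y' : EuclideanSpace ℝ (Fin 3), y' 2 = 0 ∧ dist y' y < r ∧ v (-1) y' 2 ≠ v (-1) 0 2) →
      (∀ y ∈ hotSet v, Literature.Analysis.FluidPDE.curl (v (-1)) y = 0) →
      False := by
  sorry

/-- **KERNEL `cellC2a_of_reductions : R1 → R2 → R3 → R4 → C2a′ → C2a`** (sorry-free bookkeeping). -/
theorem cellC2a_of_reductions (h1 : HotSetClosedCritical) (h2 : VortexLineHot) (h3 : NoCompactIsolatedHotPiece)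
    (h4 : HotSetNoInterior)
    (hres : ∀ (C : ℝ) (v : ℝ → EuclideanSpace ℝ (Fin 3) → EuclideanSpace ℝ (Fin 3)) (W : Set (ℝ × EuclideanSpace ℝ (Fin 3))),
      Pinned C v → ThickWindow v W → Peakless v →
      (∀ s < 0, ∀ y, ⟪fderiv ℝ (v s) y (Literature.Analysis.FluidPDE.curl (v s) y), EuclideanSpace.single 2 1⟫_ℝ = 0) →
      IsClosed (hotSet v) → (∀ y ∈ hotSet v, fderiv ℝ (fun x => v (-1) x 2) y = 0) →
      (∀ K O : Set (EuclideanSpace ℝ (Fin 3)), IsCompact K → K.Nonempty → K ⊆ hotSet v → IsOpen O → K ⊆ O →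
        O ∩ hotSet v ⊆ K → False) →
      (∀ y ∈ hotSet v, ∀ r : ℝ, 0 < r →
        ∃ y' : EuclideanSpace ℝ (Fin 3), y' 2 = 0 ∧ dist y' y < r ∧ v (-1) y' 2 ≠ v (-1) 0 2) →
      (∃ (γ : ℝ → EuclideanSpace ℝ (Fin 3)) (ε : ℝ), 0 < ε ∧ γ 0 ∈ hotSet v ∧
        Literature.Analysis.FluidPDE.curl (v (-1)) (γ 0) ≠ 0 ∧
        ∀ τ ∈ Set.Ioo (-ε) ε, HasDerivAt γ (Literature.Analysis.FluidPDE.curl (v (-1)) (γ τ)) τ ∧ γ τ ∈ hotSet v) →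
      False) :
    ∀ (C : ℝ) (v : ℝ → EuclideanSpace ℝ (Fin 3) → EuclideanSpace ℝ (Fin 3)) (W : Set (ℝ × EuclideanSpace ℝ (Fin 3))),
      Pinned C v → ThickWindow v W → Peakless v →
      (∃ y : EuclideanSpace ℝ (Fin 3), y 2 = 0 ∧ v (-1) y 2 ≠ v (-1) 0 2) →
      (∀ s < 0, ∀ y, ⟪fderiv ℝ (v s) y (Literature.Analysis.FluidPDE.curl (v s) y), EuclideanSpace.single 2 1⟫_ℝ = 0) →
      (∃ y : EuclideanSpace ℝ (Fin 3), y 2 = 0 ∧ v (-1) y 2 = v (-1) 0 2 ∧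
        Literature.Analysis.FluidPDE.curl (v (-1)) y ≠ 0) →
      False := by
  intro C v W hP hTW hPk hnon hFL hhot
  obtain ⟨y₀, hy₀0, hy₀N, hω⟩ := hhot
  have hy₀H : y₀ ∈ hotSet v := ⟨hy₀0, hy₀N⟩
  obtain ⟨hcl, hcrit⟩ := h1 C v hP
  obtain ⟨γ, ε, hε, hγ0, hγ⟩ := h2 C v hP hFL y₀ hy₀H
  refine hres C v W hP hTW hPk hFL hcl hcrit (h3 C v hP hPk) (h4 C v hP hnon) ⟨γ, ε, hε, ?_, ?_, hγ⟩
  · rw [hγ0]; exact hy₀H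
  · rw [hγ0]; exact hω

/-- **KERNEL `cellC2b_of_reductions : R1 → R3 → R4 → C2b′ → C2b`** (sorry-free bookkeeping). -/
theorem cellC2b_of_reductions (h1 : HotSetClosedCritical) (h3 : NoCompactIsolatedHotPiece) (h4 : HotSetNoInterior)
    (hres : ∀ (C : ℝ) (v : ℝ → EuclideanSpace ℝ (Fin 3) → EuclideanSpace ℝ (Fin 3)) (W : Set (ℝ × EuclideanSpace ℝ (Fin 3))),
      Pinned C v → ThickWindow v W → Peakless v →
      (∀ s < 0, ∀ y, ⟪fderiv ℝ (v s) y (Literature.Analysis.FluidPDE.curl (v s) y), EuclideanSpace.single 2 1⟫_ℝ = 0) →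
      IsClosed (hotSet v) → (∀ y ∈ hotSet v, fderiv ℝ (fun x => v (-1) x 2) y = 0) →
      (∀ K O : Set (EuclideanSpace ℝ (Fin 3)), IsCompact K → K.Nonempty → K ⊆ hotSet v → IsOpen O → K ⊆ O →
        O ∩ hotSet v ⊆ K → False) →
      (∀ y ∈ hotSet v, ∀ r : ℝ, 0 < r →
        ∃ y' : EuclideanSpace ℝ (Fin 3), y' 2 = 0 ∧ dist y' y < r ∧ v (-1) y' 2 ≠ v (-1) 0 2) →
      (∀ y ∈ hotSet v, Literature.Analysis.FluidPDE.curl (v (-1)) y = 0) →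
      False) :
    ∀ (C : ℝ) (v : ℝ → EuclideanSpace ℝ (Fin 3) → EuclideanSpace ℝ (Fin 3)) (W : Set (ℝ × EuclideanSpace ℝ (Fin 3))),
      Pinned C v → ThickWindow v W → Peakless v →
      (∃ y : EuclideanSpace ℝ (Fin 3), y 2 = 0 ∧ v (-1) y 2 ≠ v (-1) 0 2) →
      (∀ s < 0, ∀ y, ⟪fderiv ℝ (v s) y (Literature.Analysis.FluidPDE.curl (v s) y), EuclideanSpace.single 2 1⟫_ℝ = 0) →
      (∀ y : EuclideanSpace ℝ (Fin 3), y 2 = 0 → v (-1) y 2 = v (-1) 0 2 →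
        Literature.Analysis.FluidPDE.curl (v (-1)) y = 0) →
      False := by
  intro C v W hP hTW hPk hnon hFL hnull
  obtain ⟨hcl, hcrit⟩ := h1 C v hP
  exact hres C v W hP hTW hPk hFL hcl hcrit (h3 C v hP hPk) (h4 C v hP hnon) (fun y hy => hnull y hy.1 hy.2)


/-- **Cell C2a `stub_cellC2a` — HOT NON-STATIONARY VORTEX LINE ⇒ ∅ (OPEN).**  (v1.2: the FROZEN LAW `(ω·∇)v ⊥ e₃` at all past times is an
explicit hypothesis, supplied BY NAME from `…FirstIntegral.stub_firstIntegral` in the kernel — the closer's first step «the vortex line through a hot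
point is hot» starts from it.)  A pinned, thick, peakless profile whose hot set in `P₀` is not the
whole plane but contains a point with non-zero vorticity (hence, `v₂` being a first integral of the planar vorticity field, a whole non-closed,
non-stationary vortex line of hot points — unbounded, or a bounded arc ending on hot vorticity zeros) does not exist.  Why it might fail: only curve-wise information (`∇v₂ = 0`, `ω ⊥ ∂_z v_h`, `σ∂_z p ≤
−|N|/2 + σ∂_zz v₂` ON the line); no comparison principle (finite-jet barrier for local attacks).  Census §C2. -/
theorem stub_cellC2a :
    ∀ (C : ℝ) (v : ℝ → EuclideanSpace ℝ (Fin 3) → EuclideanSpace ℝ (Fin 3)) (W : Set (ℝ × EuclideanSpace ℝ (Fin 3))),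
      Pinned C v → ThickWindow v W → Peakless v →
      (∃ y : EuclideanSpace ℝ (Fin 3), y 2 = 0 ∧ v (-1) y 2 ≠ v (-1) 0 2) →
      (∀ s < 0, ∀ y, ⟪fderiv ℝ (v s) y (Literature.Analysis.FluidPDE.curl (v s) y), EuclideanSpace.single 2 1⟫_ℝ = 0) →
      (∃ y : EuclideanSpace ℝ (Fin 3), y 2 = 0 ∧ v (-1) y 2 = v (-1) 0 2 ∧
        Literature.Analysis.FluidPDE.curl (v (-1)) y ≠ 0) →
      False :=
  cellC2a_of_reductions stub_hotSetClosedCritical stub_vortexLineHot stub_noCompactIsolatedHotPiece stub_hotSetNoInterior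
    stub_cellC2aRidge

/-- **Cell C2b `stub_cellC2b` — NULL RIDGE ⇒ ∅ (OPEN).**  (v1.2: carries the frozen law by name, as C2a.)  A pinned, thick, peakless profile whose hot set in `P₀` is not the whole plane and
consists of vorticity zeros (so on it `ω = 0`, `∇v₂ = 0`, `∂_z v_h = 0`, `Dv` a trace-free planar strain) does not exist.  Why it might fail:
jets at the ridge are consistent to every finite order (Cartan–Kähler); a kill must use the global bound or the ancient history.  Census §C2. -/
theorem stub_cellC2b :
    ∀ (C : ℝ) (v : ℝ → EuclideanSpace ℝ (Fin 3) → EuclideanSpace ℝ (Fin 3)) (W : Set (ℝ × EuclideanSpace ℝ (Fin 3))),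
      Pinned C v → ThickWindow v W → Peakless v →
      (∃ y : EuclideanSpace ℝ (Fin 3), y 2 = 0 ∧ v (-1) y 2 ≠ v (-1) 0 2) →
      (∀ s < 0, ∀ y, ⟪fderiv ℝ (v s) y (Literature.Analysis.FluidPDE.curl (v s) y), EuclideanSpace.single 2 1⟫_ℝ = 0) →
      (∀ y : EuclideanSpace ℝ (Fin 3), y 2 = 0 → v (-1) y 2 = v (-1) 0 2 →
        Literature.Analysis.FluidPDE.curl (v (-1)) y = 0) →
      False :=
  cellC2b_of_reductions stub_hotSetClosedCritical stub_noCompactIsolatedHotPiece stub_hotSetNoInterior stub_cellC2bRidge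

/-! ## Kernel: HL3′ ⇐ A1 ∧ C1 ∧ C2a ∧ C2b -/

/-- **HL3′ from the split** — the statement of `stub_peaklessEmpty` (hot_loops v4.3 / loop_island, VERBATIM) from A1 and the three cells, by the
two case distinctions «is every point of `P₀` hot?» and «is every hot point of `P₀` a vorticity zero?».  Kernel-checked; no analysis. -/
theorem peaklessEmpty_of_split
    (hA1 : ∀ (C : ℝ) (v : ℝ → EuclideanSpace ℝ (Fin 3) → EuclideanSpace ℝ (Fin 3)), Pinned C v →
      (∀ y : EuclideanSpace ℝ (Fin 3), y 2 = 0 → v (-1) y 2 = v (-1) 0 2) →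
      ∀ y : EuclideanSpace ℝ (Fin 3), y 2 = 0 →
        v (-1) y = v (-1) 0 ∧ fderiv ℝ (fun x => v (-1) x 2) y (EuclideanSpace.single 2 1) = 0)
    (hC1 : ∀ (C : ℝ) (v : ℝ → EuclideanSpace ℝ (Fin 3) → EuclideanSpace ℝ (Fin 3)) (W : Set (ℝ × EuclideanSpace ℝ (Fin 3))),
      Pinned C v → ThickWindow v W → Peakless v →
      (∀ y : EuclideanSpace ℝ (Fin 3), y 2 = 0 →
        v (-1) y = v (-1) 0 ∧ fderiv ℝ (fun x => v (-1) x 2) y (EuclideanSpace.single 2 1) = 0) → False)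
    (hC2a : ∀ (C : ℝ) (v : ℝ → EuclideanSpace ℝ (Fin 3) → EuclideanSpace ℝ (Fin 3)) (W : Set (ℝ × EuclideanSpace ℝ (Fin 3))),
      Pinned C v → ThickWindow v W → Peakless v →
      (∃ y : EuclideanSpace ℝ (Fin 3), y 2 = 0 ∧ v (-1) y 2 ≠ v (-1) 0 2) →
      (∀ s < 0, ∀ y, ⟪fderiv ℝ (v s) y (Literature.Analysis.FluidPDE.curl (v s) y), EuclideanSpace.single 2 1⟫_ℝ = 0) →
      (∃ y : EuclideanSpace ℝ (Fin 3), y 2 = 0 ∧ v (-1) y 2 = v (-1) 0 2 ∧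
        Literature.Analysis.FluidPDE.curl (v (-1)) y ≠ 0) → False)
    (hC2b : ∀ (C : ℝ) (v : ℝ → EuclideanSpace ℝ (Fin 3) → EuclideanSpace ℝ (Fin 3)) (W : Set (ℝ × EuclideanSpace ℝ (Fin 3))),
      Pinned C v → ThickWindow v W → Peakless v →
      (∃ y : EuclideanSpace ℝ (Fin 3), y 2 = 0 ∧ v (-1) y 2 ≠ v (-1) 0 2) →
      (∀ s < 0, ∀ y, ⟪fderiv ℝ (v s) y (Literature.Analysis.FluidPDE.curl (v s) y), EuclideanSpace.single 2 1⟫_ℝ = 0) →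
      (∀ y : EuclideanSpace ℝ (Fin 3), y 2 = 0 → v (-1) y 2 = v (-1) 0 2 →
        Literature.Analysis.FluidPDE.curl (v (-1)) y = 0) → False) :
    ∀ (C : ℝ) (v : ℝ → EuclideanSpace ℝ (Fin 3) → EuclideanSpace ℝ (Fin 3)),
      Literature.Analysis.FluidPDE.HasTypeITimeDecay C v →
      ContinuousOn (Function.uncurry v) (Set.Iio (0 : ℝ) ×ˢ Set.univ) →
      (∀ s t : ℝ, s < t → t < 0 → ∀ x, v t x =
        Literature.Analysis.UnboundedOperators.heatExtension (v s) (t - s) x -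
          Literature.Analysis.FluidPDE.oseenDuhamel 1 s v v t x) →
      (∀ t < 0, Literature.Analysis.FluidPDE.VectorCalculus.IsDivFree (v t)) →
      (∀ s < 0, ∀ y, ⟪Literature.Analysis.FluidPDE.curl (v s) y, EuclideanSpace.single 2 1⟫_ℝ = 0) →
      v (-1) 0 2 ≠ 0 → (∀ t < 0, ∀ x, Real.sqrt (-t) * |v t x 2| ≤ |v (-1) 0 2|) →
      (∀ h : EuclideanSpace ℝ (Fin 3), fderiv ℝ (v (-1)) 0 h 2 = 0) →
      (deriv (fun s => v s 0 2) (-1) = v (-1) 0 2 / 2 ∧ v (-1) 0 2 * (Δ (fun y => v (-1) y 2)) 0 ≤ 0) →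
      ∀ W : Set (ℝ × EuclideanSpace ℝ (Fin 3)), IsOpen W → W ⊆ Set.Iio (0 : ℝ) ×ˢ Set.univ →
        (∀ z ∈ W, (Literature.Analysis.FluidPDE.curl (v z.1) z.2 ≠ 0 ∧
            (fderiv ℝ (v z.1) z.2 (EuclideanSpace.single 0 1) 2 ≠ 0 ∨ fderiv ℝ (v z.1) z.2 (EuclideanSpace.single 1 1) 2 ≠ 0) ∧
            (fderiv ℝ (v z.1) z.2 (EuclideanSpace.single 2 1) 0 ≠ 0 ∨ fderiv ℝ (v z.1) z.2 (EuclideanSpace.single 2 1) 1 ≠ 0)) ∧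
          (fderiv ℝ (fun x => fderiv ℝ (v z.1) x (EuclideanSpace.single 2 1) 2) z.2 (EuclideanSpace.single 0 1) *
                fderiv ℝ (v z.1) z.2 (EuclideanSpace.single 1 1) 2 -
              fderiv ℝ (fun x => fderiv ℝ (v z.1) x (EuclideanSpace.single 2 1) 2) z.2 (EuclideanSpace.single 1 1) *
                fderiv ℝ (v z.1) z.2 (EuclideanSpace.single 0 1) 2 ≠ 0)) →
        (∀ m : ℝ → ℝ → ℝ, ∀ W₁ : Set (ℝ × EuclideanSpace ℝ (Fin 3)), W₁ ⊆ W → IsOpen W₁ → W₁.Nonempty →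
            ∃ z ∈ W₁, ∃ b : Fin 3, b ≠ 2 ∧
              fderiv ℝ (v z.1) z.2 (EuclideanSpace.single 2 1) b ≠
                m z.1 (z.2 2) * fderiv ℝ (v z.1) z.2 (EuclideanSpace.single b 1) 2) →
        (∀ r : ℝ, 0 < r → (Metric.ball ((-1 : ℝ), (0 : EuclideanSpace ℝ (Fin 3))) r ∩ W).Nonempty) →
        (∀ (s z₀ σ M : ℝ) (K O : Set (EuclideanSpace ℝ (Fin 3))), s < 0 →
          ((σ = 1 ∨ σ = -1) ∧ IsCompact K ∧ K.Nonempty ∧ (∀ y ∈ K, y 2 = z₀ ∧ σ * v s y 2 = M) ∧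
            IsOpen O ∧ K ⊆ O ∧ (∀ y ∈ O, y 2 = z₀ → σ * v s y 2 ≤ M) ∧
            (∀ y ∈ O, y 2 = z₀ → σ * v s y 2 = M → y ∈ K)) → False) →
        False := by
  intro C v hrate hcont hmild hdiv hpol hV hsup hgrad hpins W hWo hWs hW hnTH hacc hpeak
  have hP : Pinned C v := ⟨hrate, hcont, hmild, hdiv, hpol, hV, hsup, hgrad, hpins⟩
  have hT : ThickWindow v W := ⟨hWo, hWs, hW, hnTH, hacc⟩
  have hK : Peakless v := hpeak
  have hF : ∀ s < 0, ∀ y, ⟪fderiv ℝ (v s) y (Literature.Analysis.FluidPDE.curl (v s) y), EuclideanSpace.single 2 1⟫_ℝ = 0 :=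
    Summit.NavierStokesRegularity.NavierStokesRegularity.Theorems.PoloidalWindowDoorPoloidalWindowRigidityFirstIntegral.stub_firstIntegral
      C v hrate hcont hmild hdiv (EuclideanSpace.single 2 1) hpol
  by_cases hplane : ∀ y : EuclideanSpace ℝ (Fin 3), y 2 = 0 → v (-1) y 2 = v (-1) 0 2
  · exact hC1 C v W hP hT hK (hA1 C v hP hplane)
  · push Not at hplane
    obtain ⟨y, hy0, hyne⟩ := hplane
    by_cases hnull : ∀ y : EuclideanSpace ℝ (Fin 3), y 2 = 0 → v (-1) y 2 = v (-1) 0 2 →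
        Literature.Analysis.FluidPDE.curl (v (-1)) y = 0
    · exact hC2b C v W hP hT hK ⟨y, hy0, hyne⟩ hF hnull
    · push Not at hnull
      obtain ⟨y', hy'0, hy'hot, hy'curl⟩ := hnull
      exact hC2a C v W hP hT hK ⟨y, hy0, hyne⟩ hF ⟨y', hy'0, hy'hot, hy'curl⟩

/-! ## The two shared research stubs of the column (verbatim) -/

/-- **SHARED STUB S0 ((TH) column) — VERBATIM `stub_localTHEmptyHypNUGRS`** of `Cruxes/LrcModEntire/Lines/twist_split.lean` = hot_loops v4.3 =
loop_island.  One landing closes it everywhere. -/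
theorem stub_localTHEmptyHypNUGRS :
    ∀ (u : ℝ → EuclideanSpace ℝ (Fin 3) → EuclideanSpace ℝ (Fin 3)) (μ A : ℝ → ℝ → ℝ)
      (U : Set (ℝ × EuclideanSpace ℝ (Fin 3))) (p₀ : ℝ × EuclideanSpace ℝ (Fin 3)),
      IsOpen U → p₀ ∈ U →
      AnalyticOnNhd ℝ (Function.uncurry u) U →
      (∀ p ∈ U, AnalyticAt ℝ (Function.uncurry μ) (p.1, p.2 2)) →
      (∀ p ∈ U, AnalyticAt ℝ (Function.uncurry A) (p.1, p.2 2)) →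
      (∀ p ∈ U, fderiv ℝ (u p.1) p.2 (EuclideanSpace.single 0 1) 1 = fderiv ℝ (u p.1) p.2 (EuclideanSpace.single 1 1) 0) →
      (∀ p ∈ U, fderiv ℝ (u p.1) p.2 (EuclideanSpace.single 0 1) 0 + fderiv ℝ (u p.1) p.2 (EuclideanSpace.single 1 1) 1 +
        fderiv ℝ (u p.1) p.2 (EuclideanSpace.single 2 1) 2 = 0) →
      (∀ p ∈ U, ∀ b : Fin 3, b ≠ 2 →
        fderiv ℝ (u p.1) p.2 (EuclideanSpace.single 2 1) b =
          μ p.1 (p.2 2) * fderiv ℝ (u p.1) p.2 (EuclideanSpace.single b 1) 2) →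
      (∀ p ∈ U,
        (1 - μ p.1 (p.2 2)) *
            (deriv (fun s => u s p.2 2) p.1 + fderiv ℝ (fun y => u p.1 y 2) p.2 (u p.1 p.2)
              - Δ (fun y => u p.1 y 2) p.2) =
          A p.1 (p.2 2) + (deriv (fun s => μ s (p.2 2)) p.1 - deriv (deriv (μ p.1)) (p.2 2)) * u p.1 p.2 2
            + deriv (μ p.1) (p.2 2) / 2 * u p.1 p.2 2 ^ 2
            - 2 * deriv (μ p.1) (p.2 2) * fderiv ℝ (u p.1) p.2 (EuclideanSpace.single 2 1) 2) →
      fderiv ℝ (fun y => fderiv ℝ (u p₀.1) y (EuclideanSpace.single 2 1) 2) p₀.2 (EuclideanSpace.single 0 1) *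
            fderiv ℝ (u p₀.1) p₀.2 (EuclideanSpace.single 1 1) 2 -
          fderiv ℝ (fun y => fderiv ℝ (u p₀.1) y (EuclideanSpace.single 2 1) 2) p₀.2 (EuclideanSpace.single 1 1) *
            fderiv ℝ (u p₀.1) p₀.2 (EuclideanSpace.single 0 1) 2 ≠ 0 →
      μ p₀.1 (p₀.2 2) ≠ 0 → μ p₀.1 (p₀.2 2) ≠ 1 → deriv (μ p₀.1) (p₀.2 2) ≠ 0 →
      μ p₀.1 (p₀.2 2) < 0 →
      (fderiv ℝ (u p₀.1) p₀.2 (EuclideanSpace.single 0 1) 0 ≠ fderiv ℝ (u p₀.1) p₀.2 (EuclideanSpace.single 1 1) 1 ∨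
        fderiv ℝ (u p₀.1) p₀.2 (EuclideanSpace.single 1 1) 0 ≠ 0) →
      u p₀.1 p₀.2 = 0 → 
      fderiv ℝ (u p₀.1) p₀.2 (EuclideanSpace.single 0 1) 2 = 0 →
      fderiv ℝ (u p₀.1) p₀.2 (EuclideanSpace.single 1 1) 2 = 1 → False := by
  sorry

/-- **THE WALL ⟨27893⟩ BY NAME (`stub_wall`)** — item `LoopPeriodRatchet.FrequencyGrowthExponent` (rank 2, OPEN, under `cdisprove-27893`); by
`Lines/loop_island.lean` it is equivalent to NoIslands («no nonzero class poloidal profile has an island bracket»).  Used only to feed the landed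
reduction; the split above does not use it. -/
theorem stub_wall : FrequencyGrowthExponent := by
  sorry

/-! ## Compositions to the crux items BY NAME -/

/-- **HL3′ (the statement of `stub_peaklessEmpty`, verbatim) on this line** = the split fed with the four stubs. -/
theorem hotSplit_peaklessEmpty :
    ∀ (C : ℝ) (v : ℝ → EuclideanSpace ℝ (Fin 3) → EuclideanSpace ℝ (Fin 3)),
      Literature.Analysis.FluidPDE.HasTypeITimeDecay C v →
      ContinuousOn (Function.uncurry v) (Set.Iio (0 : ℝ) ×ˢ Set.univ) →
      (∀ s t : ℝ, s < t → t < 0 → ∀ x, v t x =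
        Literature.Analysis.UnboundedOperators.heatExtension (v s) (t - s) x -
          Literature.Analysis.FluidPDE.oseenDuhamel 1 s v v t x) →
      (∀ t < 0, Literature.Analysis.FluidPDE.VectorCalculus.IsDivFree (v t)) →
      (∀ s < 0, ∀ y, ⟪Literature.Analysis.FluidPDE.curl (v s) y, EuclideanSpace.single 2 1⟫_ℝ = 0) →
      v (-1) 0 2 ≠ 0 → (∀ t < 0, ∀ x, Real.sqrt (-t) * |v t x 2| ≤ |v (-1) 0 2|) →
      (∀ h : EuclideanSpace ℝ (Fin 3), fderiv ℝ (v (-1)) 0 h 2 = 0) →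
      (deriv (fun s => v s 0 2) (-1) = v (-1) 0 2 / 2 ∧ v (-1) 0 2 * (Δ (fun y => v (-1) y 2)) 0 ≤ 0) →
      ∀ W : Set (ℝ × EuclideanSpace ℝ (Fin 3)), IsOpen W → W ⊆ Set.Iio (0 : ℝ) ×ˢ Set.univ →
        (∀ z ∈ W, (Literature.Analysis.FluidPDE.curl (v z.1) z.2 ≠ 0 ∧
            (fderiv ℝ (v z.1) z.2 (EuclideanSpace.single 0 1) 2 ≠ 0 ∨ fderiv ℝ (v z.1) z.2 (EuclideanSpace.single 1 1) 2 ≠ 0) ∧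
            (fderiv ℝ (v z.1) z.2 (EuclideanSpace.single 2 1) 0 ≠ 0 ∨ fderiv ℝ (v z.1) z.2 (EuclideanSpace.single 2 1) 1 ≠ 0)) ∧
          (fderiv ℝ (fun x => fderiv ℝ (v z.1) x (EuclideanSpace.single 2 1) 2) z.2 (EuclideanSpace.single 0 1) *
                fderiv ℝ (v z.1) z.2 (EuclideanSpace.single 1 1) 2 -
              fderiv ℝ (fun x => fderiv ℝ (v z.1) x (EuclideanSpace.single 2 1) 2) z.2 (EuclideanSpace.single 1 1) *
                fderiv ℝ (v z.1) z.2 (EuclideanSpace.single 0 1) 2 ≠ 0)) →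
        (∀ m : ℝ → ℝ → ℝ, ∀ W₁ : Set (ℝ × EuclideanSpace ℝ (Fin 3)), W₁ ⊆ W → IsOpen W₁ → W₁.Nonempty →
            ∃ z ∈ W₁, ∃ b : Fin 3, b ≠ 2 ∧
              fderiv ℝ (v z.1) z.2 (EuclideanSpace.single 2 1) b ≠
                m z.1 (z.2 2) * fderiv ℝ (v z.1) z.2 (EuclideanSpace.single b 1) 2) →
        (∀ r : ℝ, 0 < r → (Metric.ball ((-1 : ℝ), (0 : EuclideanSpace ℝ (Fin 3))) r ∩ W).Nonempty) →
        (∀ (s z₀ σ M : ℝ) (K O : Set (EuclideanSpace ℝ (Fin 3))), s < 0 →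
          ((σ = 1 ∨ σ = -1) ∧ IsCompact K ∧ K.Nonempty ∧ (∀ y ∈ K, y 2 = z₀ ∧ σ * v s y 2 = M) ∧
            IsOpen O ∧ K ⊆ O ∧ (∀ y ∈ O, y 2 = z₀ → σ * v s y 2 ≤ M) ∧
            (∀ y ∈ O, y 2 = z₀ → σ * v s y 2 = M → y ∈ K)) → False) →
        False :=
  peaklessEmpty_of_split stub_hotPlaneConst stub_cellC1 stub_cellC2a stub_cellC2b

/-- **The crux `PoloidalWindowRigidity` (K2, stmt-NavierStokesRegularity-19708) BY NAME ⇐ S0 ∧ ⟨27893⟩ ∧ A1 ∧ C1 ∧ C2a ∧ C2b**: tree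
`…HotLoopsReduction.poloidalWindowRigidity_of_NUGRS_of_growth_of_peakless`.  CONDITIONAL; no summit is proved. -/
theorem PoloidalWindowRigidity_of_hotSplit :
    Summit.NavierStokesRegularity.NavierStokesRegularity.Theses.PoloidalWindowDoor.PoloidalWindowRigidity :=
  PoloidalWindowDoorPoloidalWindowRigidityHotLoopsReduction.poloidalWindowRigidity_of_NUGRS_of_growth_of_peakless
    stub_localTHEmptyHypNUGRS stub_wall hotSplit_peaklessEmpty

/-- **The item `LrcModEntire` (stmt-NavierStokesRegularity-20428) BY NAME ⇐ S0 ∧ ⟨27893⟩ ∧ A1 ∧ C1 ∧ C2a ∧ C2b.** CONDITIONAL. -/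
theorem LrcModEntire_of_hotSplit :
    Summit.NavierStokesRegularity.NavierStokesRegularity.Theses.PoloidalWindowDoor.LrcModEntire :=
  PoloidalWindowDoorPoloidalWindowRigidityHotLoopsReduction.lrcModEntire_of_NUGRS_of_growth_of_peakless
    stub_localTHEmptyHypNUGRS stub_wall hotSplit_peaklessEmpty

end Summit.NavierStokesRegularity.NavierStokesRegularity.Cruxes.PoloidalWindowRigidity.HotSplit
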